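import Mathlib
import Literature.MathematicalPhysics.QuantumFieldTheory.MagnenRivasseauSeneor1993.MRS93LemmaVI2Reduction
import Literature.MathematicalPhysics.QuantumFieldTheory.MagnenRivasseauSeneor1993.MRS93AppendixFeynmanGauge
import HarnessLib

/-!
# Magnen–Rivasseau–Sénéor, *Construction of YM₄ with an infrared cutoff* (CMP 155, 1993), §VI: LEMMA VI.2 IN THE FEYNMAN GAUGE
# ζ = 1 — the determinants (VI.13)/(VI.15) computed from the printed matrices (VI.6)–(VI.10), the explicit angle-averaged integrand
# of (VI.14)/Lemma VI.2 at ζ = 1, and a kernel proof of the three inputs of `MRS93LemmaVI2Reduction` for it — hence of the body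
# of Lemma VI.2 (VI.20a/b) at ζ = 1, with explicit constants

statement-level skeleton of published theorems with citation tags; proofs where landed; nothing here is a claim about the
Yang–Mills mass gap, about continuum YM₄ on T⁴, or about the Clay problem

**Citation header (reproduction of PUBLISHED work).** J. Magnen, V. Rivasseau, R. Sénéor, *Construction of YM₄ with an infrared
cutoff*, Commun. Math. Phys. **155** (1993) 325–383 [MagnenRivasseauSeneor1993], Sect. VI pp.368–374 [PDF 44–50] and Appendix 1
pp.378–379 [PDF 54–55] (held scan `paper:magnen1993-cmp155-mrs-ym4-infrared-cutoff`, PDF sha256 fa4ddac3…; page images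
`run/shared/lean/pub/lit-balaban/inprint/lit-balaban-p14/renders-cmp155/p45_full_s6.png` (VI.2)–(VI.7), `p46_full_s6.png`
(VI.8)–(VI.12), `p48_full_s6.png` (VI.13)–(VI.15), `p50_*` Lemma VI.2, `p55_full_s6.png` (A.6)). Cell pub-balaban-gaps (YM blitz,
track G3), seat mrs-lit-2 (gen 2); record `run/shared/lean/pub/pub-balaban-gaps/g3/MRS-AS-PRINTED-estimates.md`. Imports
`MRS93LemmaVI2Reduction.lean` (the three named inputs `Stability.SmallBetaExpansion` / `MiddleRangeBound` / `LargeBetaLinear` and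
`Stability.lemmaVI2_at_of_inputs`), `MRS93AppendixFeynmanGauge.lean` ((A.6) `AppendixOne.ineq_A6`, (A.28) `AppendixOne.A28_eq`) and,
through them, `MRS93StabilityEstimate.lean` ((VI.15) as printed, `Stability.onePlusBetaP_feynman`) and `MRS93OneLoopCounterterms.lean`
(the hyperspherical angular integrals `OneLoop.integral_sin_sq_zero_pi` …).

**Grade of record (lit-balaban YM-INPRINT.md row D1).** Lemma VI.2: **SKETCH** («it is easy to check», p.374 tl.8). THIS FILE
PROVES the body of Lemma VI.2 **in the Feynman gauge ζ = 1 only** — the case the paper calls «tractable» (p.373 tl.37–39: «But in Appendix A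
we provide also an explicit computation of (VI.14) in the tractable case of the Feynman gauge ζ = 1 which the reader might find enlightening») and the only case in which the
polynomial `P` is printed ((VI.15)). For the homothetic gauge ζ ≈ 3/13 the construction actually uses, `P` is the 12 × 12 determinant
(VI.9), not computed in print, and Lemma VI.2 stays SKETCH. The route taken is the paper's own («We will prove Lemma VI.1 using a crude bound which follows form [sic] (VI.17) and
the fact that the polynomial P has a fixed number of (in principle) computable coefficients», p.373 tl.35–36), NOT the contour integrals
(A.3)–(A.5), (A.7)–(A.26) of Appendix 1, which are not formalised.

**What the paper prints (verbatim, from the page images).**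
* p.369 [PDF 45] (VI.2): «BF = δ_μν + (κ(p)/p²)[−(D²δ_μσ − (1 − ζ)G_μD_σ)(δ_σν + (ζ⁻¹ − 1)p_σp_ν/p²) − p²δ_μν]» [sic «G_μD_σ»;
  (VI.9) prints the same factor as «(1 − ζ)P_μP_σ»; it carries `(1 − ζ)` either way]; tl.22–23: «We write
  ψ = κ_{i,α}(p²)/p². It is convenient to define P_μ such that D_μ = iP_μ (in Fourier space). With these conventions we have in su(2)
  space:» (VI.6) «P₀ = diag(p₀,p₀,p₀), P₃ = diag(p₃,p₃,p₃), P₁ = (p₁ 0 0; 0 p₁ −ix; 0 ix p₁), P₂ = (p₂ 0 iy; 0 p₂ 0; −iy 0 p₂)»;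
  «The Fadeev-Popov operator K_FP = −∂·D = Σ_μ p_μP_μ is K_FP = (p² 0 ip₂y; 0 p² −ip₁x; −ip₂y ip₁x p²). (VI.7)»
* p.370 [PDF 46] (VI.8): «The hermitian matrix −D² = P² is −D² = P² = (p²+y² 0 2ip₂y; 0 p²+x² −2ip₁x; −2ip₂y 2ip₁x p²+x²+y²)»;
  (VI.9): «BF = δ_μν + ψ[(P²δ_μσ − (1 − ζ)P_μP_σ)(δ_σν + (ζ⁻¹ − 1)p_σp_ν/p²) − p²δ_μν] = δ_μν(1 + ψU) + ψ(p_μp_ν/p²)V + ψW_μν»,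
  (VI.10): «U = P² − p² = (y² 0 2ip₂y; 0 x² −2ip₁x; −2ip₂y 2ip₁x x²+y²)»; (VI.11): every entry of `V` carries a factor `(1/ζ − 1)` or
  `(1/ζ − ζ)`; (VI.12a–i) pp.370–371: every entry of the blocks `W_μν` carries a factor `(1 − ζ)`, `(1 − ζ)²`, `(ζ − 1/ζ)` or `(1 − 1/ζ)`.
* p.372 [PDF 48] (VI.13): «FP = 1 + ψ(K_FP − p²) = (1 0 iψp₂y; 0 1 −iψp₁x; −iψp₂y iψp₁x 1)»; tl.8–17: «We introduce the variables
  u ≡ p²M^{−2i}, θ and φ such that p₁² = uM^{2i}cos²θ and p₂² = uM^{2i}sin²θcos²φ. Then d⁴p is proportional to M^{4i}udu sin²θ sinφ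
  dθdφ. … We put v = p²/x² = uM^{2i}/x², β = κ_k(u)/v = x²M^{−2i}κ_k(u)/u …, κ = κ_k(u) and y = tx, t ∈ [0,1].»; (VI.14): the first
  bracket of the exponent is «∫u du (2/π)∫₀^π sin²θdθ (1/2)∫₀^π sinφdφ × ln|1 − βκ[cos²θ + t²sin²θcos²φ]| − (1/2)ln(1 + βP(β,κ,t,cosθ,
  sinφ,ζ,1/ζ))» and the second «∫u du (β/2)[6(1 + (1/ζ − 1)/4) − κ(4 + 3(1/ζ − 1)/2)](1 + t²)»; tl.33–36 and (VI.15): «In the case of the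
  Feynman gauge ζ = 1, this determinant simplifies into a three by three determinant to the fourth power, which is easily computed, and one
  finds: (1 + βP(β,κ,t,cosθ,sinφ,ζ,1/ζ)) = [[1 + 2β(1 − 2κ(cos²θ + t²sin²θcos²φ)) + β²] + βt²[2 − β(t² + 3 − 4κ(cos²θ + sin²θcos²φ))
  + β²(1 + t²)]]⁴. (VI.15)»
* p.374 [PDF 50] Lemma VI.2 (VI.20a/b), verbatim in `MRS93StabilityEstimate.lean` (`Stability.LemmaVI2Printed`): the angular average of
  the first bracket plus «(β/2)[6(1 + (1/ζ−1)/4) − κ(4 + 3(1/ζ−1)/2)](1 + t²)» is «≤ K₂β if β ≥ (K₁)⁻¹; ≤ −(β/8) if β ≤ (K₁)⁻¹».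
* p.379 [PDF 55] (A.6): «The third order polynomial in β in (VI.15) becomes if we put τ = t²: [1 + 2β(1 − 2κ(cos²θ + τ sin²θcos²φ)) +
  β²] + βτ[2 + β(τ + 3 − 4κ(cos²θ + sin²θcos²φ)) + β²(1 + τ)] ≥ [1 + 2β(1 − 2(cos²θ + τ sin²θcos²φ)) + β²] + 7βτ/4. (A.6)»

**AS-PRINTED FINDING (sign of one monomial).** (VI.15) p.372 prints the `t²`-bracket as `2 − β(t² + 3 − 4κA′) + β²(1 + t²)`, (A.6)
p.379 — introduced by «the third order polynomial in β in (VI.15) becomes» — prints `2 + β(τ + 3 − 4κA′) + β²(1 + τ)`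
(`A′ = cos²θ + sin²θcos²φ`). The kernel computation below of `det(1 + ψU)` from the printed `U` (VI.10) under the printed substitutions of
p.372 (`ψx² = β`, `ψy² = βt²`, `ψ²p₁²x² = βκcos²θ`, `ψ²p₂²y² = βt²κ sin²θcos²φ`) gives the (A.6) form (`det_onePlusPsiU_subst`); so
(VI.15) carries a sign misprint in that monomial (`VI15_asPrinted_eq_corrected_sub`, `VI15_asPrinted_ne_det` exhibits a point where the
two differ). The first order in `β` is the same for both forms, so (VI.16)–(VI.19), the tree's `Stability.onePlusBetaP_feynman_firstOrder`
and `Stability.feynman_firstOrder_matches_VI17` are unaffected; the tree's (A.6)/(A.28) lemmas (`AppendixOne.ineq_A6`, `A28_eq`,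
`A28_nonneg`, `A28_eq_zero_iff`) are stated on the correct (determinant) polynomial. Nothing of record changes grade.

**What is proved here (zero `sorry`, zero named facts; every hypothesis explicit).**
* §1 `Pmat`, `sum_Pmat_sq_eq_VI8` — (VI.8) `Σ_μ P_μ² = P²` from (VI.6); `KFP_eq_VI7` — (VI.7) `Σ_μ p_μP_μ`; `det_FP3` — the
  determinant of (VI.13) is `1 − ψ²p₁²x² − ψ²p₂²y²`, i.e. (`det_FP3_subst`) `1 − βκ[cos²θ + t²sin²θcos²φ]`, the argument of the first
  logarithm of (VI.14); `Vmat_one` — the block `V` (VI.11) vanishes at ζ = 1 (so `BF|_{ζ=1} = δ_μν ⊗ (1 + ψU)`, `BFone`,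
  `det_BFone : det = det(1 + ψU)⁴`); `det_onePlusPsiU` / `det_onePlusPsiU_subst` — `det(1 + ψU)` = the (A.6) cubic `feynmanCubic`.
* §2 `feynmanCubic` (the corrected (VI.15) inner bracket), `onePlusBetaP_feynmanDet := feynmanCubic⁴`, the sign finding.
* §3 the printed angular average `angAvg h := (2/π)∫₀^π sin²θ dθ · (1/2)∫₀^π sinφ dφ · h θ φ`, `angAvg_affine_A`
  (`⟨c₀ + c₁(cos²θ + t²sin²θcos²φ)⟩ = c₀ + c₁(1 + t²)/4`, from the `OneLoop` integrals), two monotonicity lemmas.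
* §4 the explicit ζ = 1 integrand `feynmanIntegrand β κ t θ φ := ln|1 − βκA| − (1/2)ln(onePlusBetaP_feynmanDet) + (β/2)(6 − 4κ)(1 + t²)`
  and `feynmanF β κ t ζ := angAvg (feynmanIntegrand β κ t)` (the `ζ`-slot of the reduction's interface is not used: this IS the ζ = 1
  integrand).
* §5 (H1) `smallBetaExpansion_feynman : SmallBetaExpansion feynmanF 1 (1/16) 100` — pointwise `ln(1 − z) ≤ −z`, `ln(1 + y) ≥ y − 2y²`
  (`|y| ≤ 1/2`), then `⟨A⟩ = (1 + t²)/4`: `F ≤ −β(1 + t²)(1 + κ/4) + 100β² ≤ −β/4 + 100β²`.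
* §6 (H3) `largeBetaLinear_feynman` from `β ≥ a := min (1/16) (1/801)` — `ln|1 − βκA| ≤ β`, `S ≥ 4β sin²θ sin²φ` ((A.6) + (A.28)),
  `−x ln x ≤ 1 − x`: `F ≤ 7β + L₀ + 2π + 8`, `L₀ = −2 ln(4a)`; (H2) `middleRangeBound_feynman` on `[a, a]`.
* §7 `lemmaVI2_feynmanGauge` — the body of Lemma VI.2 at ζ = 1: `∃ K₁ K₂ > 0, ∀ β ≥ 0, κ, t ∈ [0,1], (K₁⁻¹ ≤ β → F ≤ K₂β) ∧
  (β ≤ K₁⁻¹ → F ≤ −β/8)`, by `Stability.lemmaVI2_at_of_inputs`; (v1.1) `dressingFactor_le_one_feynman` — the tree's (VI.35) assembly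
  `Stability.dressingFactor_le_one` with its Lemma VI.2 hypotheses DISCHARGED at ζ = 1 (remaining named inputs: the representation
  (VI.14) of `ln g`, integrability, (III.7) `|log η| ≤ CT₄`, `K₁K₂ ≤ |log η|`).
* §8 (v1.1) Appendix 1 (A.26) p.382 kernel-checked: the cancellation of `(1 − w)` in the printed `s`-integrand (`A26_integrand_cancel`),
  the `s`-integral `= −4 − 3τ − (κ/2)(1 + τ)` (`A26_sIntegral`), the same slope from the angular average of the (A.7) first order
  (`A26_slope_angAvg`), and «more negative than when τ = 0» (`A26_slope_le_tau_zero`).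
* §9 (v1.1) (VI.14) fourth bracket = the Sect. III `A⁴` graphs `G₁ + κG₂ + κ²(G₃ + G₄)` of the tree's `OneLoop`
  (`VI14_quarticBracket_eq_graphs`), vanishing at `κ = 1` (`VI14_quarticBracket_kappa_one`).

**Readings (declared).** (i) `(1 + βP)|_{ζ=1} := det BF|_{ζ=1} = det(1 + ψU)⁴` (p.372 tl.33–36 with (VI.9)–(VI.12) at ζ = 1, where `V`
and `W` vanish); we use the determinant, i.e. the (A.6) sign. (ii) The Bochner/interval integrals of Mathlib define `angAvg`; where an
integrand is not integrable Mathlib's integral is `0` — in the small-β regime (β ≤ 1/16) the integrand is continuous on the closed square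
(proved), and the large-β inequality `F ≤ K₂β` is proved for the Mathlib value in all cases (the majorant is integrable and nonnegative).
(iii) Lean's `Real.log` is `log|·|` with `log 0 = 0`; the printed `ln|1 − βκ[…]|` is typed with the absolute value. (iv) ζ = 1 lies in the
printed range «0 ≤ ζ ≤ 1» of Lemma VI.2 (image p50_top_s2.png).

**What is NOT claimed.** Lemma VI.2 for ζ ≠ 1 (in particular for the homothetic gauge ζ ≈ 3/13 of the construction); the polynomial `P`
of (VI.9) for ζ ≠ 1; Lemma VI.1 as printed (its η-bookkeeping (VI.35) is `Stability.dressingFactor_le_one`; `dressingFactor_le_one_feynman`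
removes only the Lemma VI.2 hypotheses, at ζ = 1, and does not derive the representation (VI.14)); the closed forms (A.3)–(A.5),
(A.7)–(A.25); anything about the expansion, the infrared cutoff (fixed, never lifted), T⁴, or Bałaban's papers.
-/

noncomputable section

open Real MeasureTheory intervalIntegral Set

namespace Literature.MathematicalPhysics.QuantumFieldTheory.MagnenRivasseauSeneor1993

namespace FeynmanGauge

/-! ## §1 The su(2) matrices (VI.6)–(VI.8), (VI.10), (VI.13) and their determinants at ζ = 1 -/

section Matrices

open Complex Matrix

/-- (VI.6) p.369 [PDF 45]: «P₀ = diag(p₀), P₃ = diag(p₃), P₁ = (p₁ 0 0; 0 p₁ −ix; 0 ix p₁), P₂ = (p₂ 0 iy; 0 p₂ 0; −iy 0 p₂)» — the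
covariant momenta `D_μ = iP_μ` in su(2) space for the background `B₁¹ = x/λ`, `B₂² = y/λ` (p.369 tl.11).
[cite: MagnenRivasseauSeneor1993, §VI (VI.6) p.369] -/
def Pmat (p₀ p₁ p₂ p₃ x y : ℝ) : Fin 4 → Matrix (Fin 3) (Fin 3) ℂ
  | 0 => !![(p₀ : ℂ), 0, 0; 0, (p₀ : ℂ), 0; 0, 0, (p₀ : ℂ)]
  | 1 => !![(p₁ : ℂ), 0, 0; 0, (p₁ : ℂ), -(I * x); 0, I * x, (p₁ : ℂ)]
  | 2 => !![(p₂ : ℂ), 0, I * y; 0, (p₂ : ℂ), 0; -(I * y), 0, (p₂ : ℂ)]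
  | 3 => !![(p₃ : ℂ), 0, 0; 0, (p₃ : ℂ), 0; 0, 0, (p₃ : ℂ)]

/-- (VI.8) p.370 [PDF 46]: «−D² = P² = (p²+y² 0 2ip₂y; 0 p²+x² −2ip₁x; −2ip₂y 2ip₁x p²+x²+y²)», with `p² = p₀² + p₁² + p₂² + p₃²`.
[cite: MagnenRivasseauSeneor1993, §VI (VI.8) p.370] -/
def Psq (p₀ p₁ p₂ p₃ x y : ℝ) : Matrix (Fin 3) (Fin 3) ℂ :=
  let psq : ℂ := (p₀ : ℂ) ^ 2 + (p₁ : ℂ) ^ 2 + (p₂ : ℂ) ^ 2 + (p₃ : ℂ) ^ 2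
  !![psq + (y : ℂ) ^ 2, 0, 2 * I * p₂ * y; 0, psq + (x : ℂ) ^ 2, -(2 * I * p₁ * x);
    -(2 * I * p₂ * y), 2 * I * p₁ * x, psq + (x : ℂ) ^ 2 + (y : ℂ) ^ 2]

set_option linter.unnecessarySeqFocus false in
/-- **(VI.8) from (VI.6)**: `Σ_μ P_μP_μ = P²` as printed (kernel-checked matrix identity). [cite: MagnenRivasseauSeneor1993, §VI (VI.6), (VI.8) pp.369–370] -/
theorem sum_Pmat_sq_eq_VI8 (p₀ p₁ p₂ p₃ x y : ℝ) :
    ∑ μ : Fin 4, Pmat p₀ p₁ p₂ p₃ x y μ * Pmat p₀ p₁ p₂ p₃ x y μ = Psq p₀ p₁ p₂ p₃ x y := by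
  ext i j
  simp only [Fin.sum_univ_four, Matrix.add_apply]
  fin_cases i <;> fin_cases j <;>
    simp [Pmat, Psq, Matrix.mul_apply, Fin.sum_univ_three] <;> ring_nf <;> simp [Complex.I_sq] <;> ring

/-- (VI.7) p.369 [PDF 45]: «K_FP = −∂·D = Σ_μ p_μP_μ = (p² 0 ip₂y; 0 p² −ip₁x; −ip₂y ip₁x p²)».
[cite: MagnenRivasseauSeneor1993, §VI (VI.7) p.369] -/
def KFP (p₀ p₁ p₂ p₃ x y : ℝ) : Matrix (Fin 3) (Fin 3) ℂ :=
  let psq : ℂ := (p₀ : ℂ) ^ 2 + (p₁ : ℂ) ^ 2 + (p₂ : ℂ) ^ 2 + (p₃ : ℂ) ^ 2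
  !![psq, 0, I * p₂ * y; 0, psq, -(I * p₁ * x); -(I * p₂ * y), I * p₁ * x, psq]

set_option linter.unnecessarySeqFocus false in
/-- **(VI.7) from (VI.6)**: `Σ_μ p_μP_μ = K_FP` as printed. [cite: MagnenRivasseauSeneor1993, §VI (VI.6), (VI.7) p.369] -/
theorem KFP_eq_VI7 (p₀ p₁ p₂ p₃ x y : ℝ) :
    ∑ μ : Fin 4, (![(p₀ : ℂ), p₁, p₂, p₃] μ) • Pmat p₀ p₁ p₂ p₃ x y μ = KFP p₀ p₁ p₂ p₃ x y := by
  ext i j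
  simp only [Fin.sum_univ_four, Matrix.add_apply, Matrix.smul_apply, smul_eq_mul]
  fin_cases i <;> fin_cases j <;> simp [Pmat, KFP] <;> ring

/-- (VI.13) p.372 [PDF 48]: «FP = 1 + ψ(K_FP − p²) = (1 0 iψp₂y; 0 1 −iψp₁x; −iψp₂y iψp₁x 1)», typed with the two real entries
`m₁ = ψp₁x`, `m₂ = ψp₂y`. [cite: MagnenRivasseauSeneor1993, §VI (VI.13) p.372] -/
def FP3 (m₁ m₂ : ℝ) : Matrix (Fin 3) (Fin 3) ℂ :=
  !![1, 0, I * m₂; 0, 1, -(I * m₁); -(I * m₂), I * m₁, 1]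

set_option linter.unnecessarySeqFocus false in
/-- (VI.13) is `1 + ψ(K_FP − p²)` entrywise (with `m₁ = ψp₁x`, `m₂ = ψp₂y`). [cite: MagnenRivasseauSeneor1993, §VI (VI.13) p.372] -/
theorem FP3_eq (ψ p₀ p₁ p₂ p₃ x y : ℝ) :
    FP3 (ψ * p₁ * x) (ψ * p₂ * y) =
      1 + (ψ : ℂ) • (KFP p₀ p₁ p₂ p₃ x y -
        (((p₀ : ℂ) ^ 2 + (p₁ : ℂ) ^ 2 + (p₂ : ℂ) ^ 2 + (p₃ : ℂ) ^ 2) • (1 : Matrix (Fin 3) (Fin 3) ℂ))) := by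
  ext i j
  fin_cases i <;> fin_cases j <;> simp [FP3, KFP, Matrix.smul_apply] <;> ring

/-- **det FP** (the 3 × 3 determinant of (VI.13)): `det FP = 1 − (ψp₁x)² − (ψp₂y)²`.
[cite: MagnenRivasseauSeneor1993, §VI (VI.13)–(VI.14) p.372] -/
theorem det_FP3 (m₁ m₂ : ℝ) : (FP3 m₁ m₂).det = ((1 - m₁ ^ 2 - m₂ ^ 2 : ℝ) : ℂ) := by
  rw [FP3, Matrix.det_fin_three]
  simp
  ring_nf
  simp [Complex.I_sq]
  ring

/-- (VI.10) p.370 [PDF 46]: `1 + ψU` with «U = P² − p² = (y² 0 2ip₂y; 0 x² −2ip₁x; −2ip₂y 2ip₁x x²+y²)» — the 3 × 3 block of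
`BF` at ζ = 1 ((VI.9): `BF = δ_μν(1 + ψU) + ψ(p_μp_ν/p²)V + ψW_μν`, and every entry of `V` (VI.11) and of `W` (VI.12) carries a factor
`(1/ζ − 1)`, `(1/ζ − ζ)`, `(1 − ζ)`, `(1 − ζ)²`, `(ζ − 1/ζ)` or `(1 − 1/ζ)`, all vanishing at ζ = 1), typed with the real entries `X = ψx²`, `Y = ψy²`, `m₁ = ψp₁x`, `m₂ = ψp₂y`.
[cite: MagnenRivasseauSeneor1993, §VI (VI.9)–(VI.10) p.370] -/
def onePlusPsiU (X Y m₁ m₂ : ℝ) : Matrix (Fin 3) (Fin 3) ℂ :=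
  !![1 + (Y : ℂ), 0, 2 * I * m₂; 0, 1 + (X : ℂ), -(2 * I * m₁); -(2 * I * m₂), 2 * I * m₁, 1 + (X : ℂ) + (Y : ℂ)]

set_option linter.unnecessarySeqFocus false in
/-- `1 + ψU` is `1 + ψ(P² − p²)` entrywise, `P²` from (VI.8). [cite: MagnenRivasseauSeneor1993, §VI (VI.8), (VI.10) p.370] -/
theorem onePlusPsiU_eq (ψ p₀ p₁ p₂ p₃ x y : ℝ) :
    onePlusPsiU (ψ * x ^ 2) (ψ * y ^ 2) (ψ * p₁ * x) (ψ * p₂ * y) =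
      1 + (ψ : ℂ) • (Psq p₀ p₁ p₂ p₃ x y -
        (((p₀ : ℂ) ^ 2 + (p₁ : ℂ) ^ 2 + (p₂ : ℂ) ^ 2 + (p₃ : ℂ) ^ 2) • (1 : Matrix (Fin 3) (Fin 3) ℂ))) := by
  ext i j
  fin_cases i <;> fin_cases j <;> simp [onePlusPsiU, Psq, Matrix.smul_apply] <;> ring

/-- (VI.11) p.370 [PDF 46]: «V = ((1/ζ − 1)y² 0 (1/ζ − ζ)ip₂y; 0 (1/ζ − 1)x² −(1/ζ − ζ)ip₁x; −(1/ζ − ζ)ip₂y (1/ζ − ζ)ip₁x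
(1/ζ − 1)(x² + y²))» — the block multiplying `ψ p_μp_ν/p²` in (VI.9). [cite: MagnenRivasseauSeneor1993, §VI (VI.11) p.370] -/
def Vmat (ζ x y p₁ p₂ : ℝ) : Matrix (Fin 3) (Fin 3) ℂ :=
  !![((1 / ζ - 1) * y ^ 2 : ℝ), 0, ((1 / ζ - ζ : ℝ) : ℂ) * I * p₂ * y;
    0, ((1 / ζ - 1) * x ^ 2 : ℝ), -(((1 / ζ - ζ : ℝ) : ℂ) * I * p₁ * x);
    -(((1 / ζ - ζ : ℝ) : ℂ) * I * p₂ * y), ((1 / ζ - ζ : ℝ) : ℂ) * I * p₁ * x, ((1 / ζ - 1) * (x ^ 2 + y ^ 2) : ℝ)]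

set_option linter.unnecessarySeqFocus false in
/-- **At ζ = 1 the block `V` of (VI.9) vanishes** (every entry of (VI.11) carries `(1/ζ − 1)` or `(1/ζ − ζ)`); likewise every entry
of the blocks `W_μν` (VI.12a–i) p.370–371 carries one of the factors `(1 − ζ)`, `(1 − ζ)²`, `(ζ − 1/ζ)`, `(1 − 1/ζ)`, so that (VI.9) reads
`BF|_{ζ=1} = δ_μν(1 + ψU)` — «this determinant simplifies into a three by three determinant to the fourth power» (p.372 tl.34–35).
[cite: MagnenRivasseauSeneor1993, §VI (VI.9), (VI.11), (VI.12) pp.370–371] -/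
theorem Vmat_one (x y p₁ p₂ : ℝ) : Vmat 1 x y p₁ p₂ = 0 := by
  ext i j
  fin_cases i <;> fin_cases j <;> simp [Vmat]

/-- `BF` at ζ = 1 ((VI.9) with `V = 0`, `W = 0`): the block-diagonal 12 × 12 matrix `δ_μν ⊗ (1 + ψU)`, `μ, ν ∈ {0,1,2,3}`.
[cite: MagnenRivasseauSeneor1993, §VI (VI.9)–(VI.10) p.370] -/
def BFone (X Y m₁ m₂ : ℝ) : Matrix (Fin 3 × Fin 4) (Fin 3 × Fin 4) ℂ :=
  Matrix.blockDiagonal fun _ : Fin 4 => onePlusPsiU X Y m₁ m₂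

/-- `det BF|_{ζ=1} = det(1 + ψU)⁴` — «a three by three determinant to the fourth power» (p.372 tl.34–35).
[cite: MagnenRivasseauSeneor1993, §VI (VI.9), (VI.15) pp.370–372] -/
theorem det_BFone (X Y m₁ m₂ : ℝ) : (BFone X Y m₁ m₂).det = (onePlusPsiU X Y m₁ m₂).det ^ 4 := by
  rw [BFone, Matrix.det_blockDiagonal, Finset.prod_const, Finset.card_univ, Fintype.card_fin]

/-- **det(1 + ψU)** (the «three by three determinant» of p.372 tl.34–35):
`det(1 + ψU) = (1 + Y)(1 + X)(1 + X + Y) − 4m₁²(1 + Y) − 4m₂²(1 + X)`. [cite: MagnenRivasseauSeneor1993, §VI (VI.10), (VI.15) pp.370–372] -/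
theorem det_onePlusPsiU (X Y m₁ m₂ : ℝ) :
    (onePlusPsiU X Y m₁ m₂).det =
      (((1 + Y) * (1 + X) * (1 + X + Y) - 4 * m₁ ^ 2 * (1 + Y) - 4 * m₂ ^ 2 * (1 + X) : ℝ) : ℂ) := by
  rw [onePlusPsiU, Matrix.det_fin_three]
  simp
  ring_nf
  simp [Complex.I_sq]
  ring

end Matrices

/-! ## §2 The Feynman-gauge polynomial: (VI.15) corrected = (A.6), and the printed sign -/

/-- The inner bracket of (VI.15) with the sign of (A.6) p.379 (= the determinant `det(1 + ψU)`, `det_onePlusPsiU_subst`):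
`S(β,κ,t,θ,φ) = [1 + 2β(1 − 2κ(cos²θ + t²sin²θcos²φ)) + β²] + βt²[2 + β(t² + 3 − 4κ(cos²θ + sin²θcos²φ)) + β²(1 + t²)]`.
[cite: MagnenRivasseauSeneor1993, §VI (VI.15) p.372; App. 1 (A.6) p.379] -/
def feynmanCubic (β κ t θ φ : ℝ) : ℝ :=
  (1 + 2 * β * (1 - 2 * κ * (Real.cos θ ^ 2 + t ^ 2 * Real.sin θ ^ 2 * Real.cos φ ^ 2)) + β ^ 2) +
    β * t ^ 2 * (2 + β * (t ^ 2 + 3 - 4 * κ * (Real.cos θ ^ 2 + Real.sin θ ^ 2 * Real.cos φ ^ 2)) + β ^ 2 * (1 + t ^ 2))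

/-- `(1 + βP)|_{ζ=1} := det BF|_{ζ=1} = det(1 + ψU)⁴ = S⁴` («a three by three determinant to the fourth power», p.372 tl.34–35).
[cite: MagnenRivasseauSeneor1993, §VI (VI.15) p.372] -/
def onePlusBetaP_feynmanDet (β κ t θ φ : ℝ) : ℝ := feynmanCubic β κ t θ φ ^ 4

/-- **The substitution of p.372 tl.8–17 into det FP**: with `ψ = κ/p²`, `p₁ = p cosθ`, `p₂ = p sinθ cosφ`, `y = tx` and
`β = κx²/p²` (so `ψx² = β`), `det FP = 1 − βκ[cos²θ + t²sin²θcos²φ]` — the argument of «ln|1 − βκ[cos²θ + t²sin²θcos²φ]|» in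
(VI.14). [cite: MagnenRivasseauSeneor1993, §VI (VI.13)–(VI.14) p.372] -/
theorem det_FP3_subst (p x t κ θ φ : ℝ) (hp : p ≠ 0) :
    (FP3 (κ / p ^ 2 * (p * Real.cos θ) * x) (κ / p ^ 2 * (p * Real.sin θ * Real.cos φ) * (t * x))).det =
      ((1 - κ * x ^ 2 / p ^ 2 * κ * (Real.cos θ ^ 2 + t ^ 2 * Real.sin θ ^ 2 * Real.cos φ ^ 2) : ℝ) : ℂ) := by
  rw [det_FP3]
  congr 1
  field_simp
  ring

/-- **The substitution of p.372 tl.8–17 into det(1 + ψU)**: with `ψ = κ/p²`, `p₁ = p cosθ`, `p₂ = p sinθ cosφ`, `y = tx`,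
`β = κx²/p²`: `det(1 + ψU) = S(β, κ, t, θ, φ)` — the (A.6) form of the cubic, i.e. (VI.15) with `+β(t² + 3 − 4κA′)`.
[cite: MagnenRivasseauSeneor1993, §VI (VI.10), (VI.15) pp.370–372; App. 1 (A.6) p.379] -/
theorem det_onePlusPsiU_subst (p x t κ θ φ : ℝ) (hp : p ≠ 0) :
    (onePlusPsiU (κ / p ^ 2 * x ^ 2) (κ / p ^ 2 * (t * x) ^ 2) (κ / p ^ 2 * (p * Real.cos θ) * x)
        (κ / p ^ 2 * (p * Real.sin θ * Real.cos φ) * (t * x))).det =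
      ((feynmanCubic (κ * x ^ 2 / p ^ 2) κ t θ φ : ℝ) : ℂ) := by
  rw [det_onePlusPsiU]
  congr 1
  unfold feynmanCubic
  field_simp
  ring

/-- **The sign finding, as an identity**: (VI.15) AS PRINTED (`Stability.onePlusBetaP_feynman`, with `−β(t² + 3 − 4κA′)`) equals
`(S − 2β²t²(t² + 3 − 4κA′))⁴`; it agrees with the determinant `S⁴` exactly where `β²t²(t² + 3 − 4κA′) = 0`.
[cite: MagnenRivasseauSeneor1993, §VI (VI.15) p.372; App. 1 (A.6) p.379] -/
theorem VI15_asPrinted_eq_corrected_sub (β κ t θ φ : ℝ) :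
    Stability.onePlusBetaP_feynman β κ t θ φ =
      (feynmanCubic β κ t θ φ -
        2 * β ^ 2 * t ^ 2 * (t ^ 2 + 3 - 4 * κ * (Real.cos θ ^ 2 + Real.sin θ ^ 2 * Real.cos φ ^ 2))) ^ 4 := by
  unfold Stability.onePlusBetaP_feynman feynmanCubic
  ring

/-- Both forms have the same first order in `β`: `S = 1 + [2(1 − 2κA) + 2t²]β + O(β²)`, so `S⁴ = 1 + [8(1 + t²) − 16κA]β + O(β²)`
as in `Stability.onePlusBetaP_feynman_firstOrder` — (VI.16)–(VI.19) are unaffected by the sign. Exact identity with an explicit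
polynomial remainder. [cite: MagnenRivasseauSeneor1993, §VI (VI.15), (VI.17) pp.372–373] -/
theorem onePlusBetaP_feynmanDet_firstOrder (β κ t θ φ : ℝ) :
    ∃ R : ℝ, onePlusBetaP_feynmanDet β κ t θ φ =
      1 + (8 * (1 + t ^ 2) - 16 * κ * (Real.cos θ ^ 2 + t ^ 2 * Real.sin θ ^ 2 * Real.cos φ ^ 2)) * β + β ^ 2 * R := by
  refine ⟨(onePlusBetaP_feynmanDet β κ t θ φ - 1 -
    (8 * (1 + t ^ 2) - 16 * κ * (Real.cos θ ^ 2 + t ^ 2 * Real.sin θ ^ 2 * Real.cos φ ^ 2)) * β) / β ^ 2, ?_⟩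
  by_cases hβ : β = 0
  · subst hβ
    simp [onePlusBetaP_feynmanDet, feynmanCubic]
  · field_simp
    ring

/-- **A point where (VI.15) as printed and the determinant differ**: at `β = 1`, `t = 1`, `θ = φ = π/2` (so `cosθ = cosφ = 0`) the
printed (VI.15) gives `(4 + (2 − 4 + 2))⁴ = 256` while `det(1 + ψU)⁴ = (4 + (2 + 4 + 2))⁴ = 20736` (any `κ`).
[cite: MagnenRivasseauSeneor1993, §VI (VI.15) p.372; App. 1 (A.6) p.379] -/
theorem VI15_asPrinted_ne_det (κ : ℝ) :
    Stability.onePlusBetaP_feynman 1 κ 1 (π / 2) (π / 2) = 256 ∧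
      onePlusBetaP_feynmanDet 1 κ 1 (π / 2) (π / 2) = 20736 := by
  constructor
  · unfold Stability.onePlusBetaP_feynman
    simp [Real.cos_pi_div_two, Real.sin_pi_div_two]
    norm_num
  · unfold onePlusBetaP_feynmanDet feynmanCubic
    simp [Real.cos_pi_div_two, Real.sin_pi_div_two]
    norm_num

/-- The cubic in powers of `β`: `S = 1 + c₁β + c₂β² + c₃β³` with `c₁ = 2(1 − 2κA) + 2t²`, `c₂ = 1 + t²(t² + 3 − 4κA′)`,
`c₃ = t²(1 + t²)`. [cite: MagnenRivasseauSeneor1993, §VI (VI.15) p.372] -/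
theorem feynmanCubic_expand (β κ t θ φ : ℝ) :
    feynmanCubic β κ t θ φ =
      1 + (2 * (1 - 2 * κ * (Real.cos θ ^ 2 + t ^ 2 * Real.sin θ ^ 2 * Real.cos φ ^ 2)) + 2 * t ^ 2) * β +
        (1 + t ^ 2 * (t ^ 2 + 3 - 4 * κ * (Real.cos θ ^ 2 + Real.sin θ ^ 2 * Real.cos φ ^ 2))) * β ^ 2 +
        t ^ 2 * (1 + t ^ 2) * β ^ 3 := by
  unfold feynmanCubic
  ring

/-- **Lower bound of the determinant cubic** ((A.6) `AppendixOne.ineq_A6` + (A.28) `AppendixOne.A28_eq`): for `β ≥ 0`, `κ ≤ 1`,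
`0 ≤ t ≤ 1` and all angles, `S ≥ (1 − β)² + 4β sin²θ(1 − t²cos²φ) + 7βt²/4 ≥ 4β sin²θ sin²φ`.
[cite: MagnenRivasseauSeneor1993, App. 1 (A.6) p.379, (A.28) p.383] -/
theorem feynmanCubic_ge (β κ t θ φ : ℝ) (hβ : 0 ≤ β) (hκ : κ ≤ 1) (ht0 : 0 ≤ t) (ht1 : t ≤ 1) :
    4 * β * Real.sin θ ^ 2 * Real.sin φ ^ 2 ≤ feynmanCubic β κ t θ φ := by
  have h6 := AppendixOne.ineq_A6 (β := β) (κ := κ) (τ := t ^ 2) hβ hκ (sq_nonneg t) θ φ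
  have h28 := AppendixOne.A28_eq β (t ^ 2) θ φ
  have hS : feynmanCubic β κ t θ φ =
      (1 + 2 * β * (1 - 2 * κ * (Real.cos θ ^ 2 + t ^ 2 * Real.sin θ ^ 2 * Real.cos φ ^ 2)) + β ^ 2) +
        β * t ^ 2 * (2 + β * (t ^ 2 + 3 - 4 * κ * (Real.cos θ ^ 2 + Real.sin θ ^ 2 * Real.cos φ ^ 2)) +
          β ^ 2 * (1 + t ^ 2)) := by
    unfold feynmanCubic; ring
  have ht2 : t ^ 2 ≤ 1 := by nlinarith
  have hcφ : Real.cos φ ^ 2 + Real.sin φ ^ 2 = 1 := Real.cos_sq_add_sin_sq φ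
  have hlow : 4 * β * Real.sin θ ^ 2 * Real.sin φ ^ 2 ≤
      (1 - β) ^ 2 + 4 * β * Real.sin θ ^ 2 * (1 - t ^ 2 * Real.cos φ ^ 2) + 7 * β * t ^ 2 / 4 := by
    have h1 : Real.sin φ ^ 2 ≤ 1 - t ^ 2 * Real.cos φ ^ 2 := by
      nlinarith [sq_nonneg (Real.cos φ), sq_nonneg t]
    have h2 : 4 * β * Real.sin θ ^ 2 * Real.sin φ ^ 2 ≤ 4 * β * Real.sin θ ^ 2 * (1 - t ^ 2 * Real.cos φ ^ 2) :=
      mul_le_mul_of_nonneg_left h1 (by positivity)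
    nlinarith [sq_nonneg (1 - β), sq_nonneg t]
  rw [hS]
  linarith [h6, h28, hlow]

/-! ## §3 The printed angular average `(2/π)∫₀^π sin²θ dθ (1/2)∫₀^π sinφ dφ` and its elementary properties -/

/-- The angular average of (VI.14)/(VI.17)/(VI.18)/Lemma VI.2 (p.372 tl.9–10 «d⁴p is proportional to M^{4i}udu sin²θ sinφ dθdφ»):
`⟨h⟩ := (2/π)∫₀^π sin²θ dθ (1/2)∫₀^π sinφ dφ h(θ, φ)` (Mathlib interval integrals).
[cite: MagnenRivasseauSeneor1993, §VI (VI.14) p.372] -/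
def angAvg (h : ℝ → ℝ → ℝ) : ℝ :=
  (2 / π) * ∫ θ in (0 : ℝ)..π, Real.sin θ ^ 2 * ((1 / 2) * ∫ φ in (0 : ℝ)..π, Real.sin φ * h θ φ)

/-- The inner `φ`-integral of an integrand affine in `cos²φ`: `∫₀^π sinφ (a + b cos²φ) dφ = 2a + 2b/3` (antiderivative
`−a cosφ − (b/3)cos³φ`). [cite: MagnenRivasseauSeneor1993, §VI (VI.18) p.373] -/
theorem integral_sin_mul_affine_cos_sq (a b : ℝ) :
    ∫ φ in (0 : ℝ)..π, Real.sin φ * (a + b * Real.cos φ ^ 2) = 2 * a + 2 * b / 3 := by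
  have hsplit : (fun φ => Real.sin φ * (a + b * Real.cos φ ^ 2)) =
      fun φ => a * Real.sin φ + b * (Real.cos φ ^ 2 * Real.sin φ) := by
    funext φ; ring
  have i1 : IntervalIntegrable (fun φ => a * Real.sin φ) volume 0 π :=
    (by fun_prop : Continuous fun φ => a * Real.sin φ).intervalIntegrable _ _
  have i2 : IntervalIntegrable (fun φ => b * (Real.cos φ ^ 2 * Real.sin φ)) volume 0 π :=
    (by fun_prop : Continuous fun φ => b * (Real.cos φ ^ 2 * Real.sin φ)).intervalIntegrable _ _
  rw [hsplit, integral_add i1 i2, intervalIntegral.integral_const_mul, intervalIntegral.integral_const_mul,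
    OneLoop.integral_sin_zero_pi, OneLoop.integral_cos_sq_mul_sin_zero_pi]
  ring

/-- **`⟨c₀ + c₁(cos²θ + t²sin²θcos²φ)⟩ = c₀ + c₁(1 + t²)/4`** — the angular average behind the first orders of (VI.17)/(VI.18)
(`⟨cos²θ⟩ = 1/4`, `⟨sin²θ⟩⟨cos²φ⟩ = 3/4 · 1/3`; the integrals are `OneLoop.integral_sin_sq_zero_pi` etc.).
[cite: MagnenRivasseauSeneor1993, §VI (VI.17)–(VI.18) p.373] -/
theorem angAvg_affine_A (c₀ c₁ t : ℝ) :
    angAvg (fun θ φ => c₀ + c₁ * (Real.cos θ ^ 2 + t ^ 2 * Real.sin θ ^ 2 * Real.cos φ ^ 2)) =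
      c₀ + c₁ * (1 + t ^ 2) / 4 := by
  unfold angAvg
  have hinner : ∀ θ : ℝ, (∫ φ in (0 : ℝ)..π,
      Real.sin φ * (c₀ + c₁ * (Real.cos θ ^ 2 + t ^ 2 * Real.sin θ ^ 2 * Real.cos φ ^ 2))) =
        2 * (c₀ + c₁ * Real.cos θ ^ 2) + 2 * (c₁ * t ^ 2 * Real.sin θ ^ 2) / 3 := by
    intro θ
    rw [← integral_sin_mul_affine_cos_sq]
    congr 1
    funext φ
    ring
  simp_rw [hinner]
  have hsplit : ∀ θ : ℝ, Real.sin θ ^ 2 * (1 / 2 * (2 * (c₀ + c₁ * Real.cos θ ^ 2) + 2 * (c₁ * t ^ 2 * Real.sin θ ^ 2) / 3)) =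
      c₀ * Real.sin θ ^ 2 + c₁ * (Real.sin θ ^ 2 * Real.cos θ ^ 2) + c₁ * t ^ 2 / 3 * Real.sin θ ^ 4 := by
    intro θ; ring
  simp_rw [hsplit]
  have i1 : IntervalIntegrable (fun θ => c₀ * Real.sin θ ^ 2) volume 0 π :=
    (by fun_prop : Continuous fun θ => c₀ * Real.sin θ ^ 2).intervalIntegrable _ _
  have i2 : IntervalIntegrable (fun θ => c₁ * (Real.sin θ ^ 2 * Real.cos θ ^ 2)) volume 0 π :=
    (by fun_prop : Continuous fun θ => c₁ * (Real.sin θ ^ 2 * Real.cos θ ^ 2)).intervalIntegrable _ _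
  have i3 : IntervalIntegrable (fun θ => c₁ * t ^ 2 / 3 * Real.sin θ ^ 4) volume 0 π :=
    (by fun_prop : Continuous fun θ => c₁ * t ^ 2 / 3 * Real.sin θ ^ 4).intervalIntegrable _ _
  rw [integral_add (i1.add i2) i3, integral_add i1 i2, intervalIntegral.integral_const_mul,
    intervalIntegral.integral_const_mul, intervalIntegral.integral_const_mul, OneLoop.integral_sin_sq_zero_pi, OneLoop.integral_sin_sq_mul_cos_sq_zero_pi, OneLoop.integral_sin_pow_four_zero_pi]
  field_simp
  ring

/-- `⟨c⟩ = c`. [cite: MagnenRivasseauSeneor1993, §VI (VI.14) p.372] -/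
theorem angAvg_const (c : ℝ) : angAvg (fun _ _ => c) = c := by
  have h := angAvg_affine_A c 0 0
  simp only [zero_mul, add_zero, zero_div] at h
  exact h

/-- Monotonicity of the angular average for integrands continuous on the whole plane (used in the small-β regime, where the
integrand has no singularity). [cite: MagnenRivasseauSeneor1993, §VI (VI.14) p.372] -/
theorem angAvg_mono_of_continuous {f g : ℝ → ℝ → ℝ} (hf : Continuous (Function.uncurry f))
    (hg : Continuous (Function.uncurry g)) (hle : ∀ θ φ, f θ φ ≤ g θ φ) : angAvg f ≤ angAvg g := by
  unfold angAvg
  have hπ : (0 : ℝ) ≤ π := Real.pi_pos.le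
  apply mul_le_mul_of_nonneg_left _ (by positivity)
  have hcf : Continuous (Function.uncurry fun θ φ => Real.sin φ * f θ φ) :=
    (Real.continuous_sin.comp continuous_snd).mul hf
  have hcg : Continuous (Function.uncurry fun θ φ => Real.sin φ * g θ φ) :=
    (Real.continuous_sin.comp continuous_snd).mul hg
  have hFf : Continuous fun θ => ∫ φ in (0 : ℝ)..π, Real.sin φ * f θ φ :=
    intervalIntegral.continuous_parametric_intervalIntegral_of_continuous' hcf 0 π
  have hFg : Continuous fun θ => ∫ φ in (0 : ℝ)..π, Real.sin φ * g θ φ :=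
    intervalIntegral.continuous_parametric_intervalIntegral_of_continuous' hcg 0 π
  apply integral_mono_on hπ
  · exact ((Real.continuous_sin.pow 2).mul (continuous_const.mul hFf)).intervalIntegrable _ _
  · exact ((Real.continuous_sin.pow 2).mul (continuous_const.mul hFg)).intervalIntegrable _ _
  intro θ _
  apply mul_le_mul_of_nonneg_left _ (sq_nonneg _)
  apply mul_le_mul_of_nonneg_left _ (by norm_num)
  apply integral_mono_on hπ
  · exact (Real.continuous_sin.mul (hf.comp (Continuous.prodMk_right θ))).intervalIntegrable _ _
  · exact (Real.continuous_sin.mul (hg.comp (Continuous.prodMk_right θ))).intervalIntegrable _ _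
  intro φ hφ
  exact mul_le_mul_of_nonneg_left (hle θ φ) (Real.sin_nonneg_of_nonneg_of_le_pi hφ.1 hφ.2)

/-- An interval integral is bounded by the integral of an integrable majorant with nonnegative integral, whether or not the minorant
is integrable (Mathlib's integral of a non-integrable function is `0`). [folklore] -/
private theorem intervalIntegral_le_of_le_Ioo {f g : ℝ → ℝ} {a b : ℝ} (hab : a ≤ b) (hg : IntervalIntegrable g volume a b)
    (hle : ∀ x ∈ Ioo a b, f x ≤ g x) (h0 : 0 ≤ ∫ x in a..b, g x) : (∫ x in a..b, f x) ≤ ∫ x in a..b, g x := by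
  by_cases hf : IntervalIntegrable f volume a b
  · exact integral_mono_on_of_le_Ioo hab hf hg hle
  · rw [integral_undef hf]
    exact h0

/-- Monotonicity of the angular average against a majorant valid on the OPEN square `(0,π)²`, nonnegative, whose weighted
`φ`-sections and weighted `θ`-marginal are integrable (used in the large-β regime, where the printed integrand has logarithmic
singularities). [cite: MagnenRivasseauSeneor1993, §VI (VI.14) p.372] -/
theorem angAvg_le_of_le_Ioo {f g : ℝ → ℝ → ℝ}
    (hgφ : ∀ θ ∈ Ioo (0 : ℝ) π, IntervalIntegrable (fun φ => Real.sin φ * g θ φ) volume 0 π)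
    (hgθ : IntervalIntegrable (fun θ => Real.sin θ ^ 2 * ((1 / 2) * ∫ φ in (0 : ℝ)..π, Real.sin φ * g θ φ)) volume 0 π)
    (hle : ∀ θ ∈ Ioo (0 : ℝ) π, ∀ φ ∈ Ioo (0 : ℝ) π, f θ φ ≤ g θ φ) (hg0 : ∀ θ φ, 0 ≤ g θ φ) :
    angAvg f ≤ angAvg g := by
  unfold angAvg
  have hπ : (0 : ℝ) ≤ π := Real.pi_pos.le
  apply mul_le_mul_of_nonneg_left _ (by positivity)
  have hinner0 : ∀ θ, 0 ≤ ∫ φ in (0 : ℝ)..π, Real.sin φ * g θ φ := fun θ =>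
    integral_nonneg hπ fun φ hφ => mul_nonneg (Real.sin_nonneg_of_nonneg_of_le_pi hφ.1 hφ.2) (hg0 θ φ)
  apply intervalIntegral_le_of_le_Ioo hπ hgθ
  · intro θ hθ
    apply mul_le_mul_of_nonneg_left _ (sq_nonneg _)
    apply mul_le_mul_of_nonneg_left _ (by norm_num)
    apply intervalIntegral_le_of_le_Ioo hπ (hgφ θ hθ) _ (hinner0 θ)
    intro φ hφ
    exact mul_le_mul_of_nonneg_left (hle θ hθ φ hφ) (Real.sin_nonneg_of_nonneg_of_le_pi hφ.1.le hφ.2.le)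
  · exact integral_nonneg hπ fun θ _ => mul_nonneg (sq_nonneg _) (mul_nonneg (by norm_num) (hinner0 θ))

/-! ## §4 The explicit ζ = 1 integrand of (VI.14) / Lemma VI.2 and its angular average -/

/-- **The integrand of Lemma VI.2 at ζ = 1** (first bracket of (VI.14) at fixed `u`, plus the counterterm bracket at ζ = 1):
`ln|1 − βκ[cos²θ + t²sin²θcos²φ]| − (1/2)ln(1 + βP)|_{ζ=1} + (β/2)[6 − 4κ](1 + t²)`, with `(1 + βP)|_{ζ=1} = det(1 + ψU)⁴`.
[cite: MagnenRivasseauSeneor1993, §VI (VI.14)–(VI.15) p.372, Lemma VI.2 p.374] -/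
def feynmanIntegrand (β κ t θ φ : ℝ) : ℝ :=
  Real.log |1 - β * κ * (Real.cos θ ^ 2 + t ^ 2 * Real.sin θ ^ 2 * Real.cos φ ^ 2)| -
    (1 / 2) * Real.log (onePlusBetaP_feynmanDet β κ t θ φ) + (β / 2) * (6 - 4 * κ) * (1 + t ^ 2)

/-- **The left-hand side of Lemma VI.2 at ζ = 1**: the angular average of `feynmanIntegrand`. The last (`ζ`) argument is the slot
of the reduction's interface `Stability.SmallBetaExpansion` etc.; it is ignored (this is the ζ = 1 integrand).
[cite: MagnenRivasseauSeneor1993, §VI Lemma VI.2 (VI.20a/b) p.374] -/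
def feynmanF (β κ t _ζ : ℝ) : ℝ := angAvg (feynmanIntegrand β κ t)

/-- The counterterm bracket at ζ = 1 is the tree's `OneLoop.countertermFirstOrder 1 κ = 6 − 4κ`.
[cite: MagnenRivasseauSeneor1993, §VI (VI.14), (VI.16) pp.372–373] -/
theorem counterterm_at_one (κ : ℝ) : OneLoop.countertermFirstOrder 1 κ = 6 - 4 * κ := by
  unfold OneLoop.countertermFirstOrder
  ring

/-- `−(1/2)ln(S⁴) = −2 ln S` (Lean's `Real.log` is `log|·|`). [cite: MagnenRivasseauSeneor1993, §VI (VI.14)–(VI.15) p.372] -/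
theorem feynmanIntegrand_eq (β κ t θ φ : ℝ) :
    feynmanIntegrand β κ t θ φ =
      Real.log |1 - β * κ * (Real.cos θ ^ 2 + t ^ 2 * Real.sin θ ^ 2 * Real.cos φ ^ 2)| -
        2 * Real.log (feynmanCubic β κ t θ φ) + (β / 2) * (6 - 4 * κ) * (1 + t ^ 2) := by
  unfold feynmanIntegrand onePlusBetaP_feynmanDet
  rw [Real.log_pow]
  push_cast
  ring


/-! ## §5 Elementary logarithm bounds and the small-β input (H1) -/

/-- `ln|1 − z| ≤ −z` for `z < 1` (`ln x ≤ x − 1`). [folklore] -/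
private theorem log_abs_one_sub_le {z : ℝ} (hz : z < 1) : Real.log |1 - z| ≤ -z := by
  have hpos : 0 < 1 - z := by linarith
  rw [abs_of_pos hpos]
  have := Real.log_le_sub_one_of_pos hpos
  linarith

/-- `ln|1 − z| ≤ z` for `z ≥ 0` (with Lean's `ln 0 = 0` at `z = 1`). [folklore] -/
private theorem log_abs_one_sub_le' {z : ℝ} (hz : 0 ≤ z) : Real.log |1 - z| ≤ z := by
  by_cases h0 : 1 - z = 0
  · rw [h0, abs_zero, Real.log_zero]
    exact hz
  · have hpos : 0 < |1 - z| := abs_pos.2 h0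
    have h1 := Real.log_le_sub_one_of_pos hpos
    have h2 : |1 - z| ≤ |(1 : ℝ)| + |z| := abs_sub 1 z
    rw [abs_one, abs_of_nonneg hz] at h2
    linarith

/-- `ln(1 + y) ≥ y − 2y²` for `|y| ≤ 1/2` (Mathlib's Taylor bound `Real.abs_log_sub_add_sum_range_le` with one term). [folklore] -/
private theorem log_one_add_ge {y : ℝ} (hy : |y| ≤ 1 / 2) : y - 2 * y ^ 2 ≤ Real.log (1 + y) := by
  have hx : |(-y)| < 1 := by rw [abs_neg]; linarith
  have h := Real.abs_log_sub_add_sum_range_le hx 1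
  have hsum : (∑ i ∈ Finset.range 1, (-y) ^ (i + 1) / ((i : ℝ) + 1)) = -y := by simp
  rw [hsum, sub_neg_eq_add, abs_neg] at h
  have hfrac : |y| ^ (1 + 1) / (1 - |y|) ≤ 2 * y ^ 2 := by
    rw [show |y| ^ (1 + 1) = y ^ 2 by rw [show (1 : ℕ) + 1 = 2 from rfl, sq_abs]]
    rw [div_le_iff₀ (by linarith)]
    nlinarith [sq_nonneg y]
  have := (abs_le.1 (h.trans hfrac)).1
  linarith

/-- Bounds on the angular quantities: `0 ≤ A ≤ 1`, `0 ≤ A′ ≤ 1` for `t² ≤ 1` (`A = cos²θ + t²sin²θcos²φ`,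
`A′ = cos²θ + sin²θcos²φ`). [folklore] -/
private theorem angular_bounds {t : ℝ} (ht0 : 0 ≤ t) (ht1 : t ≤ 1) (θ φ : ℝ) :
    0 ≤ Real.cos θ ^ 2 + t ^ 2 * Real.sin θ ^ 2 * Real.cos φ ^ 2 ∧
      Real.cos θ ^ 2 + t ^ 2 * Real.sin θ ^ 2 * Real.cos φ ^ 2 ≤ 1 ∧
      0 ≤ Real.cos θ ^ 2 + Real.sin θ ^ 2 * Real.cos φ ^ 2 ∧
      Real.cos θ ^ 2 + Real.sin θ ^ 2 * Real.cos φ ^ 2 ≤ 1 := by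
  have hc2 : 0 ≤ Real.cos θ ^ 2 := sq_nonneg _
  have hs2 : 0 ≤ Real.sin θ ^ 2 := sq_nonneg _
  have hcφ : 0 ≤ Real.cos φ ^ 2 := sq_nonneg _
  have hcφ1 : Real.cos φ ^ 2 ≤ 1 := by rw [sq_le_one_iff_abs_le_one]; exact Real.abs_cos_le_one φ
  have hpyth : Real.cos θ ^ 2 + Real.sin θ ^ 2 = 1 := Real.cos_sq_add_sin_sq θ
  have ht2 : t ^ 2 ≤ 1 := by nlinarith
  have ht2' : 0 ≤ t ^ 2 := sq_nonneg t
  refine ⟨by positivity, ?_, by positivity, ?_⟩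
  · have : t ^ 2 * Real.sin θ ^ 2 * Real.cos φ ^ 2 ≤ 1 * Real.sin θ ^ 2 * 1 := by
      apply mul_le_mul (mul_le_mul_of_nonneg_right ht2 hs2) hcφ1 hcφ (by positivity)
    linarith
  · have : Real.sin θ ^ 2 * Real.cos φ ^ 2 ≤ Real.sin θ ^ 2 * 1 := mul_le_mul_of_nonneg_left hcφ1 hs2
    linarith

/-- Bounds on the coefficients of the cubic `S = 1 + c₁β + c₂β² + c₃β³` in terms of `u = κA ∈ [0,1]`, `u′ = κA′ ∈ [0,1]`,
`s = t² ∈ [0,1]`: `c₁ = 2(1 − 2u) + 2s ∈ [−2, 4]`, `c₂ = 1 + s(s + 3 − 4u′) ∈ [0, 5]`, `c₃ = s(1 + s) ∈ [0, 2]`. [folklore] -/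
private theorem cubicCoeff_bounds {u u' s : ℝ} (hu0 : 0 ≤ u) (hu1 : u ≤ 1) (hu'0 : 0 ≤ u') (hu'1 : u' ≤ 1)
    (hs0 : 0 ≤ s) (hs1 : s ≤ 1) :
    (-2 ≤ 2 * (1 - 2 * u) + 2 * s ∧ 2 * (1 - 2 * u) + 2 * s ≤ 4) ∧
      (0 ≤ 1 + s * (s + 3 - 4 * u') ∧ 1 + s * (s + 3 - 4 * u') ≤ 5) ∧ (0 ≤ s * (1 + s) ∧ s * (1 + s) ≤ 2) := by
  refine ⟨⟨by linarith, by linarith⟩, ⟨?_, ?_⟩, ⟨by positivity, by nlinarith⟩⟩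
  · have : -1 ≤ s + 3 - 4 * u' := by linarith
    nlinarith
  · have : s + 3 - 4 * u' ≤ 4 := by linarith
    nlinarith

/-- The small-β arithmetic of the cubic: for `0 ≤ β ≤ 1/16` and coefficients in the ranges of `cubicCoeff_bounds`,
`y = c₁β + c₂β² + c₃β³` satisfies `|y| ≤ 1/2`, `y² ≤ 25β²`, `c₁β ≤ y`. [folklore] -/
private theorem cubic_smallBeta_arith {β c₁ c₂ c₃ : ℝ} (hβ0 : 0 ≤ β) (hβ1 : β ≤ 1 / 16) (h1l : -2 ≤ c₁) (h1u : c₁ ≤ 4)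
    (h2l : 0 ≤ c₂) (h2u : c₂ ≤ 5) (h3l : 0 ≤ c₃) (h3u : c₃ ≤ 2) :
    |c₁ * β + c₂ * β ^ 2 + c₃ * β ^ 3| ≤ 1 / 2 ∧ (c₁ * β + c₂ * β ^ 2 + c₃ * β ^ 3) ^ 2 ≤ 25 * β ^ 2 ∧
      c₁ * β ≤ c₁ * β + c₂ * β ^ 2 + c₃ * β ^ 3 := by
  have hβ2 : β ^ 2 ≤ β * (1 / 16) := by nlinarith
  have hβ3 : β ^ 3 ≤ β * (1 / 256) := by nlinarith
  have hc₂β : c₂ * β ^ 2 ≤ 5 * (β * (1 / 16)) := by nlinarith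
  have hc₃β : c₃ * β ^ 3 ≤ 2 * (β * (1 / 256)) := by nlinarith
  have hc₁βu : c₁ * β ≤ 4 * β := by nlinarith
  have hc₁βl : -2 * β ≤ c₁ * β := by nlinarith
  have hc₂β0 : 0 ≤ c₂ * β ^ 2 := by positivity
  have hc₃β0 : 0 ≤ c₃ * β ^ 3 := by positivity
  have hyu : c₁ * β + c₂ * β ^ 2 + c₃ * β ^ 3 ≤ 5 * β := by linarith
  have hyl : -(5 * β) ≤ c₁ * β + c₂ * β ^ 2 + c₃ * β ^ 3 := by linarith
  refine ⟨?_, ?_, by linarith⟩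
  · rw [abs_le]; constructor <;> linarith
  · nlinarith

/-- **The small-β pointwise bound (ζ = 1).** For `0 ≤ β ≤ 1/16`, `κ, t ∈ [0,1]` and all angles,
`ln|1 − βκA| − 2 ln S + β(3 − 2κ)(1 + t²) ≤ 7βκ·A − β(1 + 2κ)(1 + t²) + 100β²` (`A = cos²θ + t²sin²θcos²φ`): first orders exactly,
the `O(β²)` bounded by `100β²` («the polynomial P has a fixed number of (in principle) computable coefficients», p.373 tl.36).
[cite: MagnenRivasseauSeneor1993, §VI (VI.17)–(VI.19) pp.373–374] -/
theorem feynmanIntegrand_le_smallBeta {β κ t : ℝ} (hβ0 : 0 ≤ β) (hβ1 : β ≤ 1 / 16) (hκ0 : 0 ≤ κ) (hκ1 : κ ≤ 1)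
    (ht0 : 0 ≤ t) (ht1 : t ≤ 1) (θ φ : ℝ) :
    feynmanIntegrand β κ t θ φ ≤
      (-(β * (1 + 2 * κ) * (1 + t ^ 2)) + 100 * β ^ 2) +
        7 * β * κ * (Real.cos θ ^ 2 + t ^ 2 * Real.sin θ ^ 2 * Real.cos φ ^ 2) := by
  obtain ⟨hA0, hA1, hA'0, hA'1⟩ := angular_bounds ht0 ht1 θ φ
  obtain ⟨A, hA⟩ : ∃ A : ℝ, A = Real.cos θ ^ 2 + t ^ 2 * Real.sin θ ^ 2 * Real.cos φ ^ 2 := ⟨_, rfl⟩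
  obtain ⟨A', hA'⟩ : ∃ A' : ℝ, A' = Real.cos θ ^ 2 + Real.sin θ ^ 2 * Real.cos φ ^ 2 := ⟨_, rfl⟩
  rw [← hA] at hA0 hA1
  rw [← hA'] at hA'0 hA'1
  rw [feynmanIntegrand_eq, ← hA]
  have ht2 : t ^ 2 ≤ 1 := by nlinarith
  have ht2' : 0 ≤ t ^ 2 := sq_nonneg t
  have hκA0 : 0 ≤ κ * A := mul_nonneg hκ0 hA0
  have hκA1 : κ * A ≤ 1 := by
    have := mul_le_mul hκ1 hA1 hA0 zero_le_one
    linarith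
  have hκA'0 : 0 ≤ κ * A' := mul_nonneg hκ0 hA'0
  have hκA'1 : κ * A' ≤ 1 := by
    have := mul_le_mul hκ1 hA'1 hA'0 zero_le_one
    linarith
  -- term 1: ln|1 − βκA| ≤ −βκA
  have h1 : Real.log |1 - β * κ * A| ≤ -(β * κ * A) := by
    apply log_abs_one_sub_le
    calc β * κ * A = β * (κ * A) := by ring
      _ ≤ 1 / 16 * 1 := mul_le_mul hβ1 hκA1 hκA0 (by norm_num)
      _ < 1 := by norm_num
  -- term 2: S = 1 + y with y = c₁β + c₂β² + c₃β³, |y| ≤ 1/2, ln(1 + y) ≥ y − 2y²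
  obtain ⟨⟨h1l, h1u⟩, ⟨h2l, h2u⟩, ⟨h3l, h3u⟩⟩ :=
    cubicCoeff_bounds (s := t ^ 2) hκA0 hκA1 hκA'0 hκA'1 ht2' ht2
  have hS : feynmanCubic β κ t θ φ =
      1 + ((2 * (1 - 2 * (κ * A)) + 2 * t ^ 2) * β + (1 + t ^ 2 * (t ^ 2 + 3 - 4 * (κ * A'))) * β ^ 2 +
        t ^ 2 * (1 + t ^ 2) * β ^ 3) := by
    rw [feynmanCubic_expand, hA, hA']
    ring
  obtain ⟨hyabs, hy2, hy1⟩ := cubic_smallBeta_arith hβ0 hβ1 h1l h1u h2l h2u h3l h3u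
  have h2 : -(2 * Real.log (feynmanCubic β κ t θ φ)) ≤ -(2 * ((2 * (1 - 2 * (κ * A)) + 2 * t ^ 2) * β)) + 100 * β ^ 2 := by
    rw [hS]
    have hlog := log_one_add_ge hyabs
    linarith
  -- term 3 and assembly
  have hsum : -(β * κ * A) + (-(2 * ((2 * (1 - 2 * (κ * A)) + 2 * t ^ 2) * β)) + 100 * β ^ 2) +
      β / 2 * (6 - 4 * κ) * (1 + t ^ 2) =
      (-(β * (1 + 2 * κ) * (1 + t ^ 2)) + 100 * β ^ 2) + 7 * β * κ * A := by
    ring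
  linarith [h1, h2, hsum]

/-- In the small-β regime the integrand has no singularity: it is continuous on the whole `(θ, φ)`-plane
(`1 − βκA ≥ 15/16`, `S ≥ 1/2`). [cite: MagnenRivasseauSeneor1993, §VI (VI.14) p.372] -/
theorem continuous_feynmanIntegrand_smallBeta {β κ t : ℝ} (hβ0 : 0 ≤ β) (hβ1 : β ≤ 1 / 16) (hκ0 : 0 ≤ κ) (hκ1 : κ ≤ 1)
    (ht0 : 0 ≤ t) (ht1 : t ≤ 1) : Continuous (Function.uncurry (feynmanIntegrand β κ t)) := by
  have hS : Continuous fun q : ℝ × ℝ => feynmanCubic β κ t q.1 q.2 := by unfold feynmanCubic; fun_prop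
  have ht2 : t ^ 2 ≤ 1 := by nlinarith
  have ht2' : 0 ≤ t ^ 2 := sq_nonneg t
  have bounds : ∀ θ φ : ℝ, κ * (Real.cos θ ^ 2 + t ^ 2 * Real.sin θ ^ 2 * Real.cos φ ^ 2) ≤ 1 ∧
      1 / 2 ≤ feynmanCubic β κ t θ φ := by
    intro θ φ
    obtain ⟨hA0, hA1, hA'0, hA'1⟩ := angular_bounds ht0 ht1 θ φ
    obtain ⟨A, hA⟩ : ∃ A : ℝ, A = Real.cos θ ^ 2 + t ^ 2 * Real.sin θ ^ 2 * Real.cos φ ^ 2 := ⟨_, rfl⟩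
    obtain ⟨A', hA'⟩ : ∃ A' : ℝ, A' = Real.cos θ ^ 2 + Real.sin θ ^ 2 * Real.cos φ ^ 2 := ⟨_, rfl⟩
    rw [← hA] at hA0 hA1 ⊢
    rw [← hA'] at hA'0 hA'1
    have hκA0 : 0 ≤ κ * A := mul_nonneg hκ0 hA0
    have hκA1 : κ * A ≤ 1 := by
      have := mul_le_mul hκ1 hA1 hA0 zero_le_one
      linarith
    have hκA'0 : 0 ≤ κ * A' := mul_nonneg hκ0 hA'0
    have hκA'1 : κ * A' ≤ 1 := by
      have := mul_le_mul hκ1 hA'1 hA'0 zero_le_one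
      linarith
    refine ⟨hκA1, ?_⟩
    obtain ⟨⟨h1l, h1u⟩, ⟨h2l, h2u⟩, ⟨h3l, h3u⟩⟩ :=
      cubicCoeff_bounds (s := t ^ 2) hκA0 hκA1 hκA'0 hκA'1 ht2' ht2
    have hS : feynmanCubic β κ t θ φ =
        1 + ((2 * (1 - 2 * (κ * A)) + 2 * t ^ 2) * β + (1 + t ^ 2 * (t ^ 2 + 3 - 4 * (κ * A'))) * β ^ 2 +
          t ^ 2 * (1 + t ^ 2) * β ^ 3) := by
      rw [feynmanCubic_expand, hA, hA']
      ring
    obtain ⟨hyabs, -, -⟩ := cubic_smallBeta_arith hβ0 hβ1 h1l h1u h2l h2u h3l h3u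
    rw [hS]
    have := (abs_le.1 hyabs).1
    linarith
  have h1 : Continuous fun q : ℝ × ℝ =>
      Real.log |1 - β * κ * (Real.cos q.1 ^ 2 + t ^ 2 * Real.sin q.1 ^ 2 * Real.cos q.2 ^ 2)| := by
    refine Continuous.log (by fun_prop) fun q => ?_
    have hb := (bounds q.1 q.2).1
    have hβκ : β * κ * (Real.cos q.1 ^ 2 + t ^ 2 * Real.sin q.1 ^ 2 * Real.cos q.2 ^ 2) ≤ 1 / 16 * 1 := by
      rw [mul_assoc]
      exact mul_le_mul hβ1 hb (mul_nonneg hκ0 (angular_bounds ht0 ht1 q.1 q.2).1) (by norm_num)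
    have : 0 < 1 - β * κ * (Real.cos q.1 ^ 2 + t ^ 2 * Real.sin q.1 ^ 2 * Real.cos q.2 ^ 2) := by linarith
    exact (abs_pos.2 this.ne').ne'
  have h2 : Continuous fun q : ℝ × ℝ => Real.log (onePlusBetaP_feynmanDet β κ t q.1 q.2) := by
    unfold onePlusBetaP_feynmanDet
    refine Continuous.log (hS.pow 4) fun q => ?_
    have := (bounds q.1 q.2).2
    positivity
  have h : Continuous fun q : ℝ × ℝ => feynmanIntegrand β κ t q.1 q.2 := by
    unfold feynmanIntegrand
    exact (h1.sub (continuous_const.mul h2)).add continuous_const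
  exact h

/-- **(H1) for the Feynman gauge**: `Stability.SmallBetaExpansion feynmanF 1 (1/16) 100` — for `0 ≤ β ≤ 1/16`, `κ, t ∈ [0,1]`,
`F₁(β, κ, t) ≤ −β(1 + t²)(1 + κ/4) + 100β² ≤ −β/4 + 100β²` (the first order is (VI.18) at ζ = 1, `(β/2)(1 + t²)(−2 − κ/2)`).
[cite: MagnenRivasseauSeneor1993, §VI (VI.18)–(VI.19) pp.373–374, Lemma VI.2 (VI.20b) p.374] -/
theorem smallBetaExpansion_feynman : Stability.SmallBetaExpansion feynmanF 1 (1 / 16) 100 := by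
  intro β κ t hβ0 hβ1 hκ0 hκ1 ht0 ht1
  unfold feynmanF
  have hmono : angAvg (feynmanIntegrand β κ t) ≤
      angAvg (fun θ φ => (-(β * (1 + 2 * κ) * (1 + t ^ 2)) + 100 * β ^ 2) +
        7 * β * κ * (Real.cos θ ^ 2 + t ^ 2 * Real.sin θ ^ 2 * Real.cos φ ^ 2)) := by
    apply angAvg_mono_of_continuous (continuous_feynmanIntegrand_smallBeta hβ0 hβ1 hκ0 hκ1 ht0 ht1)
    · exact (by fun_prop : Continuous fun q : ℝ × ℝ => (-(β * (1 + 2 * κ) * (1 + t ^ 2)) + 100 * β ^ 2) +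
        7 * β * κ * (Real.cos q.1 ^ 2 + t ^ 2 * Real.sin q.1 ^ 2 * Real.cos q.2 ^ 2))
    · exact feynmanIntegrand_le_smallBeta hβ0 hβ1 hκ0 hκ1 ht0 ht1
  rw [angAvg_affine_A] at hmono
  have ht2 : 0 ≤ t ^ 2 := sq_nonneg t
  have hfinal : (-(β * (1 + 2 * κ) * (1 + t ^ 2)) + 100 * β ^ 2) + 7 * β * κ * (1 + t ^ 2) / 4 ≤
      -(β / 4) + 100 * β ^ 2 := by
    nlinarith [mul_nonneg hβ0 hκ0, mul_nonneg (mul_nonneg hβ0 hκ0) ht2, mul_nonneg hβ0 ht2]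
  exact hmono.trans hfinal

/-! ## §6 The large-β inputs (H3), (H2) -/

/-- **The large-β pointwise bound (ζ = 1) on the open square.** For `β ≥ a > 0`, `κ, t ∈ [0,1]`, `θ, φ ∈ (0, π)`:
`ln|1 − βκA| − 2 ln S + β(3 − 2κ)(1 + t²) ≤ 7β − 2 ln(4a) − 4 ln(sinθ) − 4 ln(sinφ)` — «the logarithms of explicit polynomials in
β … are bounded by a constant times β at large β» (p.374 tl.6–7) made quantitative with `S ≥ 4β sin²θ sin²φ` ((A.6), (A.28)).
[cite: MagnenRivasseauSeneor1993, §VI p.374; App. 1 (A.6) p.379, (A.28) p.383] -/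
theorem feynmanIntegrand_le_largeBeta {a β κ t : ℝ} (ha : 0 < a) (haβ : a ≤ β) (hκ0 : 0 ≤ κ) (hκ1 : κ ≤ 1)
    (ht0 : 0 ≤ t) (ht1 : t ≤ 1) {θ φ : ℝ} (hθ : θ ∈ Ioo (0 : ℝ) π) (hφ : φ ∈ Ioo (0 : ℝ) π) :
    feynmanIntegrand β κ t θ φ ≤
      7 * β - 2 * Real.log (4 * a) - 4 * Real.log (Real.sin θ) - 4 * Real.log (Real.sin φ) := by
  have hβ0 : 0 ≤ β := ha.le.trans haβ
  obtain ⟨hA0, hA1, -, -⟩ := angular_bounds ht0 ht1 θ φ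
  obtain ⟨A, hA⟩ : ∃ A : ℝ, A = Real.cos θ ^ 2 + t ^ 2 * Real.sin θ ^ 2 * Real.cos φ ^ 2 := ⟨_, rfl⟩
  rw [← hA] at hA0 hA1
  rw [feynmanIntegrand_eq, ← hA]
  -- term 1
  have h1 : Real.log |1 - β * κ * A| ≤ β := by
    have hz : 0 ≤ β * κ * A := by positivity
    have := log_abs_one_sub_le' hz
    have hκA1 : κ * A ≤ 1 := by
      have := mul_le_mul hκ1 hA1 hA0 zero_le_one
      linarith
    have : β * κ * A ≤ β := by
      calc β * κ * A = β * (κ * A) := by ring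
        _ ≤ β * 1 := mul_le_mul_of_nonneg_left hκA1 hβ0
        _ = β := mul_one β
    linarith
  -- term 2
  have hsinθ : 0 < Real.sin θ := Real.sin_pos_of_pos_of_lt_pi hθ.1 hθ.2
  have hsinφ : 0 < Real.sin φ := Real.sin_pos_of_pos_of_lt_pi hφ.1 hφ.2
  have hm : 0 < 4 * a * Real.sin θ ^ 2 * Real.sin φ ^ 2 := by positivity
  have hSge : 4 * a * Real.sin θ ^ 2 * Real.sin φ ^ 2 ≤ feynmanCubic β κ t θ φ := by
    have h := feynmanCubic_ge β κ t θ φ hβ0 hκ1 ht0 ht1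
    have hss : 0 ≤ Real.sin θ ^ 2 * Real.sin φ ^ 2 := by positivity
    have : 4 * a * (Real.sin θ ^ 2 * Real.sin φ ^ 2) ≤ 4 * β * (Real.sin θ ^ 2 * Real.sin φ ^ 2) :=
      mul_le_mul_of_nonneg_right (by linarith) hss
    linarith
  have h2 : -(2 * Real.log (feynmanCubic β κ t θ φ)) ≤
      -(2 * Real.log (4 * a)) - 4 * Real.log (Real.sin θ) - 4 * Real.log (Real.sin φ) := by
    have hlog : Real.log (4 * a * Real.sin θ ^ 2 * Real.sin φ ^ 2) ≤ Real.log (feynmanCubic β κ t θ φ) :=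
      Real.log_le_log hm hSge
    have hsplit : Real.log (4 * a * Real.sin θ ^ 2 * Real.sin φ ^ 2) =
        Real.log (4 * a) + 2 * Real.log (Real.sin θ) + 2 * Real.log (Real.sin φ) := by
      rw [Real.log_mul (by positivity) (by positivity), Real.log_mul (by positivity) (by positivity),
        Real.log_pow, Real.log_pow]
      push_cast
      ring
    linarith
  -- term 3
  have h3 : β / 2 * (6 - 4 * κ) * (1 + t ^ 2) ≤ 6 * β := by
    have ht2 : t ^ 2 ≤ 1 := by nlinarith
    have h62 : (6 - 4 * κ) * (1 + t ^ 2) ≤ 6 * 2 :=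
      mul_le_mul (by linarith) (by linarith) (by positivity) (by norm_num)
    have := mul_le_mul_of_nonneg_left h62 (by linarith : 0 ≤ β / 2)
    linarith
  linarith

/-- The constants of the large-β regime: `a := min (1/16) (1/(8·100 + 1))` — the threshold `K₁⁻¹` of Lemma VI.2 (VI.20a/b) that
`Stability.lemmaVI2_at_of_inputs` produces from (H1) («two (large…) constants K₁ and K₂», p.374 tl.9).
[cite: MagnenRivasseauSeneor1993, §VI Lemma VI.2 p.374] -/
def aConst : ℝ := min (1 / 16) (1 / (8 * 100 + 1))

/-- `L₀ := −2 ln(4a) ≥ 0`, the constant in the large-β majorant `7β + L₀ − 4 ln sinθ − 4 ln sinφ`.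
[cite: MagnenRivasseauSeneor1993, §VI Lemma VI.2 (VI.20a) p.374] -/
def L0Const : ℝ := -(2 * Real.log (4 * aConst))

/-- `C′ := 7 + (L₀ + 2π + 8)/a`, the slope of (H3) («bounded by a constant times β at large β», p.374 tl.7).
[cite: MagnenRivasseauSeneor1993, §VI Lemma VI.2 (VI.20a) p.374] -/
def CLarge : ℝ := 7 + (L0Const + 2 * π + 8) / aConst

/-- `0 < a`. [folklore] -/
private theorem aConst_pos : 0 < aConst := lt_min (by norm_num) (by norm_num)

/-- `a ≤ 1/16`. [folklore] -/
private theorem aConst_le : aConst ≤ 1 / 16 := min_le_left _ _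

/-- `0 ≤ L₀` (`4a ≤ 1`). [folklore] -/
private theorem L0Const_nonneg : 0 ≤ L0Const := by
  unfold L0Const
  have h4a0 : 0 ≤ 4 * aConst := by linarith [aConst_pos]
  have h4a1 : 4 * aConst ≤ 1 := by linarith [aConst_le]
  have := Real.log_nonpos h4a0 h4a1
  linarith

/-- `0 ≤ C′`. [folklore] -/
private theorem CLarge_nonneg : 0 ≤ CLarge := by
  unfold CLarge
  have : 0 ≤ (L0Const + 2 * π + 8) / aConst := by
    apply div_nonneg _ aConst_pos.le
    linarith [L0Const_nonneg, Real.pi_pos]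
  linarith

/-- `x ln x ≥ x − 1 ≥ −1` for `x ≥ 0` (from `ln x ≥ 1 − 1/x`; so `−sinφ ln sinφ ≤ 1`, `−sin²θ ln sinθ ≤ 1` on `[0, π]`). [folklore] -/
private theorem mul_log_ge_neg_one {x : ℝ} (hx0 : 0 ≤ x) : -1 ≤ x * Real.log x := by
  rcases hx0.eq_or_lt with h | h
  · rw [← h]; simp
  · have hlog := Real.one_sub_inv_le_log_of_pos h
    have hx : x * (1 - x⁻¹) = x - 1 := by field_simp
    have := mul_le_mul_of_nonneg_left hlog h.le
    rw [hx] at this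
    linarith

/-- The weighted `φ`-section of the large-β majorant, in closed form:
`∫₀^π sinφ (c − 4 ln sinφ) dφ = 2c − 4∫₀^π sinφ ln sinφ dφ`. [folklore] -/
private theorem integral_sin_mul_const_sub_log (c : ℝ) :
    ∫ φ in (0 : ℝ)..π, Real.sin φ * (c - 4 * Real.log (Real.sin φ)) =
      2 * c - 4 * ∫ φ in (0 : ℝ)..π, Real.sin φ * Real.log (Real.sin φ) := by
  have hsplit : (fun φ => Real.sin φ * (c - 4 * Real.log (Real.sin φ))) =
      fun φ => c * Real.sin φ - 4 * (Real.sin φ * Real.log (Real.sin φ)) := by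
    funext φ; ring
  have i1 : IntervalIntegrable (fun φ => c * Real.sin φ) volume 0 π :=
    (by fun_prop : Continuous fun φ => c * Real.sin φ).intervalIntegrable _ _
  have i2 : IntervalIntegrable (fun φ => 4 * (Real.sin φ * Real.log (Real.sin φ))) volume 0 π :=
    (continuous_const.mul (Real.continuous_mul_log.comp Real.continuous_sin)).intervalIntegrable _ _
  rw [hsplit, integral_sub i1 i2, intervalIntegral.integral_const_mul, intervalIntegral.integral_const_mul,
    OneLoop.integral_sin_zero_pi]
  ring

/-- `−π ≤ ∫₀^π sinφ ln sinφ dφ` and `−π ≤ ∫₀^π sin²θ ln sinθ dθ` (pointwise `≥ −1`). [folklore] -/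
private theorem integral_sin_mul_log_sin_ge :
    -π ≤ ∫ φ in (0 : ℝ)..π, Real.sin φ * Real.log (Real.sin φ) ∧
      -π ≤ ∫ θ in (0 : ℝ)..π, Real.sin θ ^ 2 * Real.log (Real.sin θ) := by
  have hπ : (0 : ℝ) ≤ π := Real.pi_pos.le
  have hc1 : Continuous fun φ => Real.sin φ * Real.log (Real.sin φ) :=
    Real.continuous_mul_log.comp Real.continuous_sin
  have hc2 : Continuous fun θ => Real.sin θ ^ 2 * Real.log (Real.sin θ) := by
    have : (fun θ => Real.sin θ ^ 2 * Real.log (Real.sin θ)) =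
        fun θ => Real.sin θ * (Real.sin θ * Real.log (Real.sin θ)) := by funext θ; ring
    rw [this]
    exact Real.continuous_sin.mul hc1
  have hconst : ∫ _ in (0 : ℝ)..π, (-1 : ℝ) = -π := by simp
  constructor
  · rw [← hconst]
    apply integral_mono_on hπ (by simp) (hc1.intervalIntegrable _ _)
    intro φ hφ
    exact mul_log_ge_neg_one (Real.sin_nonneg_of_nonneg_of_le_pi hφ.1 hφ.2)
  · rw [← hconst]
    apply integral_mono_on hπ (by simp) (hc2.intervalIntegrable _ _)
    intro θ hθ
    have hs0 := Real.sin_nonneg_of_nonneg_of_le_pi hθ.1 hθ.2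
    have hs1 := Real.sin_le_one θ
    have h := mul_log_ge_neg_one hs0
    have key := mul_nonneg hs0 (show 0 ≤ Real.sin θ * Real.log (Real.sin θ) + 1 by linarith)
    have : Real.sin θ ^ 2 * Real.log (Real.sin θ) =
        Real.sin θ * (Real.sin θ * Real.log (Real.sin θ) + 1) - Real.sin θ := by ring
    rw [this]
    linarith

/-- **The angular average of the large-β majorant**: `⟨c − 4 ln sinθ − 4 ln sinφ⟩ ≤ c + 2π + 8` for every real `c`. [folklore] -/
private theorem angAvg_logMajorant_le (c : ℝ) :
    angAvg (fun θ φ => c - 4 * Real.log (Real.sin θ) - 4 * Real.log (Real.sin φ)) ≤ c + 2 * π + 8 := by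
  unfold angAvg
  obtain ⟨hJ₀ge, hJ₂ge⟩ := integral_sin_mul_log_sin_ge
  set J₀ := ∫ φ in (0 : ℝ)..π, Real.sin φ * Real.log (Real.sin φ) with hJ₀
  set J₂ := ∫ θ in (0 : ℝ)..π, Real.sin θ ^ 2 * Real.log (Real.sin θ) with hJ₂
  have hinner : ∀ θ : ℝ, (∫ φ in (0 : ℝ)..π, Real.sin φ * (c - 4 * Real.log (Real.sin θ) - 4 * Real.log (Real.sin φ))) =
      2 * (c - 4 * Real.log (Real.sin θ)) - 4 * J₀ := fun θ => integral_sin_mul_const_sub_log _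
  simp_rw [hinner]
  have hsplit : (fun θ => Real.sin θ ^ 2 * (1 / 2 * (2 * (c - 4 * Real.log (Real.sin θ)) - 4 * J₀))) =
      fun θ => (c - 2 * J₀) * Real.sin θ ^ 2 - 4 * (Real.sin θ ^ 2 * Real.log (Real.sin θ)) := by
    funext θ; ring
  have hc2 : Continuous fun θ => Real.sin θ ^ 2 * Real.log (Real.sin θ) := by
    have : (fun θ => Real.sin θ ^ 2 * Real.log (Real.sin θ)) =
        fun θ => Real.sin θ * (Real.sin θ * Real.log (Real.sin θ)) := by funext θ; ring
    rw [this]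
    exact Real.continuous_sin.mul (Real.continuous_mul_log.comp Real.continuous_sin)
  have i1 : IntervalIntegrable (fun θ => (c - 2 * J₀) * Real.sin θ ^ 2) volume 0 π :=
    (by fun_prop : Continuous fun θ => (c - 2 * J₀) * Real.sin θ ^ 2).intervalIntegrable _ _
  have i2 : IntervalIntegrable (fun θ => 4 * (Real.sin θ ^ 2 * Real.log (Real.sin θ))) volume 0 π :=
    (continuous_const.mul hc2).intervalIntegrable _ _
  rw [hsplit, integral_sub i1 i2, intervalIntegral.integral_const_mul, intervalIntegral.integral_const_mul,
    OneLoop.integral_sin_sq_zero_pi]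
  have hπ0 : 0 < π := Real.pi_pos
  have hJ₂' : (∫ θ in (0 : ℝ)..π, Real.sin θ ^ 2 * Real.log (Real.sin θ)) = J₂ := rfl
  rw [hJ₂']
  rw [show 2 / π * ((c - 2 * J₀) * (π / 2) - 4 * J₂) = c - 2 * J₀ - 8 / π * J₂ by field_simp; ring]
  have h8 : -(8 / π * J₂) ≤ 8 := by
    have : 8 / π * (-J₂) ≤ 8 / π * π := mul_le_mul_of_nonneg_left (by linarith) (by positivity)
    have h' : 8 / π * π = 8 := by field_simp
    linarith
  linarith

/-- **(H3)-type bound for the Feynman gauge, all `β ≥ a`**: `F₁(β, κ, t) ≤ 7β + L₀ + 2π + 8`.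
[cite: MagnenRivasseauSeneor1993, §VI p.374 tl.6–8, Lemma VI.2 (VI.20a) p.374] -/
theorem feynmanF_le_largeBeta {β κ t : ℝ} (haβ : aConst ≤ β) (hκ0 : 0 ≤ κ) (hκ1 : κ ≤ 1) (ht0 : 0 ≤ t) (ht1 : t ≤ 1) :
    feynmanF β κ t 1 ≤ 7 * β + L0Const + 2 * π + 8 := by
  unfold feynmanF
  have hlogsin : ∀ x : ℝ, Real.log (Real.sin x) ≤ 0 := fun x => by
    rw [← Real.log_abs]
    exact Real.log_nonpos (abs_nonneg _) (Real.abs_sin_le_one x)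
  have hβ0 : 0 ≤ β := aConst_pos.le.trans haβ
  have hmono : angAvg (feynmanIntegrand β κ t) ≤
      angAvg (fun θ φ => (7 * β + L0Const) - 4 * Real.log (Real.sin θ) - 4 * Real.log (Real.sin φ)) := by
    apply angAvg_le_of_le_Ioo
    · intro θ _
      have : (fun φ => Real.sin φ * ((7 * β + L0Const) - 4 * Real.log (Real.sin θ) - 4 * Real.log (Real.sin φ))) =
          fun φ => ((7 * β + L0Const) - 4 * Real.log (Real.sin θ)) * Real.sin φ -
            4 * (Real.sin φ * Real.log (Real.sin φ)) := by
        funext φ; ring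
      rw [this]
      exact ((continuous_const.mul Real.continuous_sin).sub
        (continuous_const.mul (Real.continuous_mul_log.comp Real.continuous_sin))).intervalIntegrable _ _
    · have hJ : ∀ θ : ℝ, (∫ φ in (0 : ℝ)..π, Real.sin φ *
          ((7 * β + L0Const) - 4 * Real.log (Real.sin θ) - 4 * Real.log (Real.sin φ))) =
          2 * ((7 * β + L0Const) - 4 * Real.log (Real.sin θ)) -
            4 * ∫ φ in (0 : ℝ)..π, Real.sin φ * Real.log (Real.sin φ) :=
        fun θ => integral_sin_mul_const_sub_log _
      simp_rw [hJ]
      have : (fun θ => Real.sin θ ^ 2 * (1 / 2 * (2 * (7 * β + L0Const - 4 * Real.log (Real.sin θ)) -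
          4 * ∫ φ in (0 : ℝ)..π, Real.sin φ * Real.log (Real.sin φ)))) =
          fun θ => ((7 * β + L0Const) - 2 * ∫ φ in (0 : ℝ)..π, Real.sin φ * Real.log (Real.sin φ)) *
            Real.sin θ ^ 2 - 4 * (Real.sin θ * (Real.sin θ * Real.log (Real.sin θ))) := by
        funext θ; ring
      rw [this]
      exact ((continuous_const.mul (Real.continuous_sin.pow 2)).sub (continuous_const.mul
        (Real.continuous_sin.mul (Real.continuous_mul_log.comp Real.continuous_sin)))).intervalIntegrable _ _
    · intro θ hθ φ hφ
      have h := feynmanIntegrand_le_largeBeta aConst_pos haβ hκ0 hκ1 ht0 ht1 hθ hφ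
      unfold L0Const
      linarith
    · intro θ φ
      linarith [hlogsin θ, hlogsin φ, L0Const_nonneg]
  have hbound := angAvg_logMajorant_le (7 * β + L0Const)
  linarith

/-- **(H3) for the Feynman gauge**: `Stability.LargeBetaLinear feynmanF 1 a C′` with `a = min (1/16) (1/801)`,
`C′ = 7 + (L₀ + 2π + 8)/a`. [cite: MagnenRivasseauSeneor1993, §VI p.374 tl.6–8, Lemma VI.2 (VI.20a) p.374] -/
theorem largeBetaLinear_feynman : Stability.LargeBetaLinear feynmanF 1 aConst CLarge := by
  intro β κ t haβ hκ0 hκ1 ht0 ht1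
  have h := feynmanF_le_largeBeta haβ hκ0 hκ1 ht0 ht1
  have ha := aConst_pos
  have hβa : 1 ≤ β / aConst := by rw [le_div_iff₀ ha]; linarith
  have hK : 0 ≤ L0Const + 2 * π + 8 := by linarith [L0Const_nonneg, Real.pi_pos]
  have hlin : L0Const + 2 * π + 8 ≤ (L0Const + 2 * π + 8) / aConst * β := by
    calc L0Const + 2 * π + 8 = (L0Const + 2 * π + 8) * 1 := (mul_one _).symm
      _ ≤ (L0Const + 2 * π + 8) * (β / aConst) := mul_le_mul_of_nonneg_left hβa hK
      _ = (L0Const + 2 * π + 8) / aConst * β := by field_simp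
  unfold CLarge
  linarith

/-- **(H2) for the Feynman gauge** (the middle range degenerates to the point `β = a`):
`Stability.MiddleRangeBound feynmanF 1 a a (C′·a)`. [cite: MagnenRivasseauSeneor1993, §VI p.374 tl.4–8] -/
theorem middleRangeBound_feynman : Stability.MiddleRangeBound feynmanF 1 aConst aConst (CLarge * aConst) := by
  intro β κ t haβ hβa hκ0 hκ1 ht0 ht1
  have h := largeBetaLinear_feynman β κ t haβ hκ0 hκ1 ht0 ht1
  have : CLarge * β ≤ CLarge * aConst := mul_le_mul_of_nonneg_left hβa CLarge_nonneg
  linarith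

/-! ## §7 Lemma VI.2 in the Feynman gauge -/

/-- **Lemma VI.2 (VI.20a/b) at ζ = 1, PROVED.** For the explicit Feynman-gauge angular average `F₁` of (VI.14) (with
`(1 + βP)|_{ζ=1} = det(1 + ψU)⁴`): «there exists two (large…) constants K₁ and K₂ such that [F₁] ≤ K₂β if β ≥ (K₁)⁻¹ (VI.20a);
≤ −(β/8) if β ≤ (K₁)⁻¹ (VI.20b)» — by `Stability.lemmaVI2_at_of_inputs` from (H1) `smallBetaExpansion_feynman`, (H3)
`largeBetaLinear_feynman`, (H2) `middleRangeBound_feynman` (`K₁⁻¹ = min (1/16) (1/801)`). The homothetic-gauge case ζ ≈ 3/13 of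
the construction is NOT covered (its `P` is not computed in print). [cite: MagnenRivasseauSeneor1993, §VI Lemma VI.2 (VI.20a)–(VI.20b) p.374] -/
theorem lemmaVI2_feynmanGauge :
    ∃ K₁ K₂ : ℝ, 0 < K₁ ∧ 0 < K₂ ∧
      ∀ β κ t : ℝ, 0 ≤ β → 0 ≤ κ → κ ≤ 1 → 0 ≤ t → t ≤ 1 →
        (K₁⁻¹ ≤ β → feynmanF β κ t 1 ≤ K₂ * β) ∧ (β ≤ K₁⁻¹ → feynmanF β κ t 1 ≤ -(β / 8)) :=
  Stability.lemmaVI2_at_of_inputs (F := feynmanF) (ζ := 1) (by norm_num) (by norm_num) smallBetaExpansion_feynman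
    largeBetaLinear_feynman middleRangeBound_feynman

/-- **(VI.35) at ζ = 1 with Lemma VI.2 DISCHARGED.** The tree's kernel-checked assembly `Stability.dressingFactor_le_one` («g_k(x) ≤
exp(|Δ|x⁴[K₁K₂ − |log η|]) ≤ 1 (VI.35) if … |log η| ≥ K₁K₂», p.374) takes Lemma VI.2 as the named hypotheses `h20a`/`h20b`; in the
Feynman gauge these are now theorems (`lemmaVI2_feynmanGauge`), so for every `t ∈ [0,1]` there are `K₁, K₂ > 0` such that the dressing
factor `g` of a large-field cube is `≤ 1` given only: the representation (VI.14) of `ln g` in the variables of p.372 with the ζ = 1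
integrand `F₁` (`hrep`, `hint`), «0 ≤ κ ≤ 1» (`hκ`), (III.7) as invoked (`hCT : |log η| ≤ CT₄`) and the choice of η (`hη : K₁K₂ ≤ |log η|`).
This is Lemma VI.1 (VI.5) at ζ = 1 for that cube, modulo (VI.14) and (III.7) — NOT Lemma VI.1 as printed (homothetic gauge), and the
representation (VI.14) itself is not derived here. [cite: MagnenRivasseauSeneor1993, §VI Lemma VI.1 (VI.5) p.369, (VI.35) p.374] -/
theorem dressingFactor_le_one_feynman {t : ℝ} (ht0 : 0 ≤ t) (ht1 : t ≤ 1) :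
    ∃ K₁ K₂ : ℝ, 0 < K₁ ∧ 0 < K₂ ∧
      ∀ {g vol x η CT₄ : ℝ} {κ : ℝ → ℝ}, 0 ≤ vol → (∀ v, 0 ≤ κ v ∧ κ v ≤ 1) →
        IntegrableOn (fun v => v * feynmanF (κ v / v) (κ v) t 1) (Ioi 0) →
        Real.log g = vol * x ^ 4 * ((∫ v in Ioi 0, v * feynmanF (κ v / v) (κ v) t 1) - CT₄) →
        0 < g → |Real.log η| ≤ CT₄ → K₁ * K₂ ≤ |Real.log η| → g ≤ 1 := by
  obtain ⟨K₁, K₂, hK₁, hK₂, h⟩ := lemmaVI2_feynmanGauge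
  refine ⟨K₁, K₂, hK₁, hK₂, ?_⟩
  intro g vol x η CT₄ κ hvol hκ hint hrep hg hCT hη
  have hK₁inv : 0 ≤ K₁⁻¹ := inv_nonneg.2 hK₁.le
  refine Stability.dressingFactor_le_one (F := fun β k => feynmanF β k t 1) hvol hK₁ hK₂.le hκ ?_ ?_ hint hrep hg hCT hη
  · intro β k hk0 hk1 hβ
    exact ((h β k t (hK₁inv.trans hβ) hk0 hk1 ht0 ht1).1 hβ)
  · intro β k hk0 hk1 hβ0 hβ
    exact ((h β k t hβ0 hk0 hk1 ht0 ht1).2 hβ)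

/-! ## §8 (v1.1) Appendix 1 (A.7)/(A.26): the slope of `H` at `β = 0`, kernel-checked -/

/-- **(A.26), the `s`-integrand** p.382 [PDF 58] (image renders/p58c): «(1/2)∫_{−√τ}^{+√τ} (ds/√τ) (2/(1 − w)) × ((κ/4)(−1 − 2w +
3w²) − 2 + 8w − 6w² − 2τ′(1 − w)) = −4 − 3τ − (κ/2)(1 + τ), (A.26) using the fact that w = s².» (`τ′ ≡ 7τ/4`, p.381). The factor
`(1 − w)` cancels: `−1 − 2w + 3w² = −(1 − w)(1 + 3w)`, `−2 + 8w − 6w² = −2(1 − w)(1 − 3w)`, so for `w ≠ 1` the integrand is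
`−2[(κ/4)(1 + 3w) + 2 − 6w + 2τ′]`. [cite: MagnenRivasseauSeneor1993, App. 1 (A.26) p.382] -/
theorem A26_integrand_cancel (κ τ' w : ℝ) (hw : w ≠ 1) :
    2 / (1 - w) * (κ / 4 * (-1 - 2 * w + 3 * w ^ 2) - 2 + 8 * w - 6 * w ^ 2 - 2 * τ' * (1 - w)) =
      -2 * (κ / 4 * (1 + 3 * w) + 2 - 6 * w + 2 * τ') := by
  have h1 : 1 - w ≠ 0 := sub_ne_zero.2 (Ne.symm hw)
  field_simp
  ring

/-- **(A.26), the `s`-integral** (with the cancelled integrand, `w = s²`, `τ′ = 7τ/4`): for `τ > 0`,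
`(1/2)∫_{−√τ}^{√τ} (1/√τ)(−2[(κ/4)(1 + 3s²) + 2 − 6s² + 7τ/2]) ds = −4 − 3τ − (κ/2)(1 + τ)`.
[cite: MagnenRivasseauSeneor1993, App. 1 (A.26) p.382] -/
theorem A26_sIntegral {τ : ℝ} (hτ : 0 < τ) (κ : ℝ) :
    1 / 2 * ∫ s in (-Real.sqrt τ)..Real.sqrt τ,
        1 / Real.sqrt τ * (-2 * (κ / 4 * (1 + 3 * s ^ 2) + 2 - 6 * s ^ 2 + 2 * (7 * τ / 4))) =
      -4 - 3 * τ - κ / 2 * (1 + τ) := by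
  set a := Real.sqrt τ with ha
  have ha0 : 0 < a := Real.sqrt_pos.2 hτ
  have ha2 : a ^ 2 = τ := by rw [ha, Real.sq_sqrt hτ.le]
  have hsplit : (fun s : ℝ => 1 / a * (-2 * (κ / 4 * (1 + 3 * s ^ 2) + 2 - 6 * s ^ 2 + 2 * (7 * τ / 4)))) =
      fun s => (-(2 / a) * (κ / 4 + 2 + 7 * τ / 2)) + (-(2 / a) * (3 * κ / 4 - 6)) * s ^ 2 := by
    funext s
    field_simp
    ring
  have i1 : IntervalIntegrable (fun _ : ℝ => (-(2 / a) * (κ / 4 + 2 + 7 * τ / 2))) volume (-a) a :=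
    intervalIntegrable_const
  have i2 : IntervalIntegrable (fun s : ℝ => (-(2 / a) * (3 * κ / 4 - 6)) * s ^ 2) volume (-a) a :=
    (by fun_prop : Continuous fun s : ℝ => (-(2 / a) * (3 * κ / 4 - 6)) * s ^ 2).intervalIntegrable _ _
  rw [hsplit, integral_add i1 i2, intervalIntegral.integral_const, intervalIntegral.integral_const_mul, integral_pow]
  simp only [smul_eq_mul]
  have ha3 : a ^ 3 = τ * a := by rw [pow_succ, ha2]
  have hna3 : (-a) ^ (2 + 1) = -(τ * a) := by rw [show (2 : ℕ) + 1 = 3 from rfl, neg_pow, ha3]; norm_num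
  rw [hna3, show (2 : ℕ) + 1 = 3 from rfl, ha3]
  field_simp
  ring

/-- **(A.26) from the angular average**: the first order in `β` of the (A.7) integrand
`ln|1 − βκ(cos²θ + w sin²θ)| − 2 ln(1 + 2β(1 + 7τ/8 − 2cos²θ − 2w sin²θ) + β²)` (`w sin²θ = τ sin²θcos²φ`, `τ = t²`) is
`−βκA − 4β(1 + 7τ/8 − 2A)` with `A = cos²θ + t²sin²θcos²φ`; its average `⟨·⟩ = (2/π)∫sin²θ (1/2)∫sinφ` is
`(1/2)·(−4 − 3τ − (κ/2)(1 + τ))·β` — i.e. (A.26) («the slope of the function H near β = 0», `H = 2⟨·⟩` by the `(4/π)` of (A.7)).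
[cite: MagnenRivasseauSeneor1993, App. 1 (A.7) p.380, (A.26) p.382] -/
theorem A26_slope_angAvg (β κ t : ℝ) :
    angAvg (fun θ φ => -(β * κ * (Real.cos θ ^ 2 + t ^ 2 * Real.sin θ ^ 2 * Real.cos φ ^ 2)) -
        4 * β * (1 + 7 * t ^ 2 / 8 - 2 * (Real.cos θ ^ 2 + t ^ 2 * Real.sin θ ^ 2 * Real.cos φ ^ 2))) =
      1 / 2 * (-4 - 3 * t ^ 2 - κ / 2 * (1 + t ^ 2)) * β := by
  have h := angAvg_affine_A (-(4 * β * (1 + 7 * t ^ 2 / 8))) (8 * β - β * κ) t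
  have hfun : (fun θ φ => -(β * κ * (Real.cos θ ^ 2 + t ^ 2 * Real.sin θ ^ 2 * Real.cos φ ^ 2)) -
      4 * β * (1 + 7 * t ^ 2 / 8 - 2 * (Real.cos θ ^ 2 + t ^ 2 * Real.sin θ ^ 2 * Real.cos φ ^ 2))) =
      fun θ φ => -(4 * β * (1 + 7 * t ^ 2 / 8)) +
        (8 * β - β * κ) * (Real.cos θ ^ 2 + t ^ 2 * Real.sin θ ^ 2 * Real.cos φ ^ 2) := by
    funext θ φ; ring
  rw [hfun, h]
  ring

/-- (A.26) vs (VI.18) at ζ = 1: the (A.7) slope `−4 − 3τ − (κ/2)(1 + τ)` is MORE negative than twice the exact ζ = 1 first order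
`2·[−(1 + t²)(1 + κ/4)] + 0` would suggest only after adding the counterterm bracket: with the counterterm `2·(β/2)(6 − 4κ)(1 + τ)`
(`H`-normalisation) the total slope is `−4 − 3τ − (κ/2)(1 + τ) + (6 − 4κ)(1 + τ) = 2 + 3τ − (9κ/2)(1 + τ)`, which is NOT negative for
small `κ`: Appendix 1 closes Lemma VI.1 at ζ = 1 through the cutoff-shape bookkeeping (A.5) (regions `κ ≥ 1/2` / `κ < 1/2` and the
`x⁴|log η|` counterterm), not through the sign of this slope — whereas the exact first order (VI.18) used in §5 above,
`−(1 + t²)(1 + κ/4)` per unit `β` in the `⟨·⟩`-normalisation, IS negative. Recorded as arithmetic only («Hence the slope of the function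
H near β = 0 is more negative than when τ = 0», p.382 tl.22: indeed `−3τ − (κ/2)τ ≤ 0`). [cite: MagnenRivasseauSeneor1993, App. 1 (A.5) p.379, (A.26) p.382] -/
theorem A26_slope_le_tau_zero (κ τ : ℝ) (hκ : 0 ≤ κ) (hτ : 0 ≤ τ) :
    -4 - 3 * τ - κ / 2 * (1 + τ) ≤ -4 - κ / 2 := by
  nlinarith

/-! ## §9 (v1.1) (VI.14), fourth bracket: the quartic counterterm coefficients are the Sect. III graphs -/

/-- **(VI.14) p.372, fourth bracket, vs Sect. III.** The `β²/24`-bracket, printed in (VI.35) p.374 (image renders/p50d) as «(36 + 18(1/ζ −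
1) + 7.5(1/ζ − 1)²) − κ(90 + 45(1/ζ − 1) + 15(1/ζ − 1)²) + κ²(54 + 27(1/ζ − 1) + 7.5(1/ζ − 1)²)» (in (VI.14) itself, image
renders/p48c, the parenthesis after «15(1/ζ − 1)²» is missing [sic]; (VI.35) and Sect. III fix the reading), is, with `t = 1/ζ − 1`, exactly `G₁ + κG₂ + κ²(G₃ + G₄)` for the tree's
one-loop `A⁴` graphs of Sect. III (`OneLoop.G1 t = 36 + 18t + 7.5t²`, `G2 t = −90 − 45t − 15t²`, `G3 t + G4 = 55.5 + 27t + 7.5t² − 1.5`;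
p.373 tl.11–14 «the quartic term coming from the Fadeev-Popov determinant matches the corresponding computation of the graph G₄ in Sect.
III»), the powers `κ², κ³, κ⁴` of (III.6) appearing as `β²·(1, κ, κ²)` since `β = x²M^{−2i}κ/u`.
[cite: MagnenRivasseauSeneor1993, §VI (VI.14) p.372, p.373 tl.11–14; §III (III.6) p.352] -/
theorem VI14_quarticBracket_eq_graphs (t κ : ℝ) :
    (36 + 18 * t + 7.5 * t ^ 2) - κ * (90 + 45 * t + 15 * t ^ 2) + κ ^ 2 * (54 + 27 * t + 7.5 * t ^ 2) =
      OneLoop.G1 t + κ * OneLoop.G2 t + κ ^ 2 * (OneLoop.G3 t + OneLoop.G4) := by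
  rw [OneLoop.G1_eq, OneLoop.G3_eq, OneLoop.G4_eq]
  unfold OneLoop.G2
  ring

/-- At `κ = 1` (inside the cutoff's plateau) the fourth bracket of (VI.14) vanishes identically in ζ — the (VI.14) face of
`OneLoop.one_loop_A4_sum_eq_zero` (`G₁ + G₂ + G₃ + G₄ = 0`): the stabilizing `A⁴` term lives where `κ < 1`.
[cite: MagnenRivasseauSeneor1993, §VI (VI.14) p.372; §III (III.6)–(III.7) p.352] -/
theorem VI14_quarticBracket_kappa_one (t : ℝ) :
    (36 + 18 * t + 7.5 * t ^ 2) - 1 * (90 + 45 * t + 15 * t ^ 2) + 1 ^ 2 * (54 + 27 * t + 7.5 * t ^ 2) = 0 := by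
  ring

end FeynmanGauge

end Literature.MathematicalPhysics.QuantumFieldTheory.MagnenRivasseauSeneor1993
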